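import Literature.NumberTheory.LFunctions.BondarenkoHeap2026Section6Proofs
import Literature.NumberTheory.LFunctions.BondarenkoHeap2026Section6Weights
import Literature.NumberTheory.LFunctions.SmoothedExplicitFormulaChar
import Literature.NumberTheory.LFunctions.ZeroSumWindowBounds
import HarnessLib

/-!
# Bondarenko–Heap 2026, Lemma 10 (primes twisted by characters, averaged) from Proposition 2 — proved

A. Bondarenko, W. Heap, *Exceptional characters and small gaps between the zeros of the Riemann
zeta-function*, arXiv:2608.07399v1 (2026) [BondarenkoHeap2026], §6.5, **Lemma 10** (TeX
l.1108–1123): "Let `V` be a smooth function supported in `[1,2]` and suppose that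
`‖V^{(j)}‖_∞ ≪_j q^ε`. If `K ≥ q^{7/3+2η}`, then
`∑_{ψ mod q, ψ ∉ {ψ₀,χ}} |∑_n Λ(n)ψ(n)V(n/K)| ≪_{η,ε} K q^ε`." The statement file
`BondarenkoHeap2026Section6` types it as the named fact `lemma10` (node BH26:Lem10 of the
rh-crit/ah register, an `H` leaf of the apex cone of `bondarenkoHeap2026_theorem1`), and
**Proposition 2** (the Chen–Gupta–Li zero-density estimate with exponent `7/3`, the paper's own
citation boundary) as the named fact `prop2` (`BondarenkoHeap2026Sections3to5`). THIS FILE PROVES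
`lemma10_of_prop2 : prop2 → lemma10`, following the printed proof (TeX l.1124–1290) step by step:

1. reduction to the primitive inducing characters `ψ⋆` (l.1126–1150):
   `PrimeSums.norm_sum_sub_tsum_primitive_le` (Mathlib `primitiveCharacter_apply_of_isCoprime` and
   the tree's `sum_vonMangoldt_not_coprime_le`);
2. the Mellin decay (34) by `j`-fold integration by parts on `[1,2]`
   (`PrimeSums.mellin_eq_mellin_iteratedDeriv`, `PrimeSums.norm_mellin_le_of_iteratedDeriv`);
3. the explicit formula (35): the tree's EXACT smoothed explicit formula for primitive characters,
   `ExplicitPsiChar.charFordK_eq_explicit` (Heath-Brown 1992 Lemma 5.1 form, left line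
   `Re w = −5/2`), applied at `s = 5/4` to the admissible smoothing `f(u) = W(e^u/K) e^{5u/4}`
   (`PrimeSums.isSmoothedEFTest_smoothing`), whose Laplace transform is
   `F(5/4 − w) = K^w 𝓜W(w)` (`PrimeSums.fordLaplace_smoothing`) and whose prime sum is
   `Σ Λ(n)ξ(n)W(n/K)` (`PrimeSums.charFordK_smoothing`); here `W = Re V, Im V`;
4. the three ranges of zeros (l.1195–1242): the far zeros `|γ| > H` and the zeros with `β ≤ 1/2`
   are handled with the tree's window bound `Σ_ρ m(ρ)/(1+γ²) ≪ log q`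
   (`ExplicitPsiChar.exists_tsum_zeroOrder_div_sq_le`) in place of the aggregate count (36) — this
   is harmless because `H = q^{3η/7}` and `j = ⌈7/(3η)⌉ + 3` are ours to choose
   (`PrimeSums.norm_tsum_vonMangoldt_mul_le`);
5. the layer-cake identity (37) (`PrimeSums.layerCake_le`) and the zero-density input (38):
   `prop2` at every conductor `d ∣ q` (characters inject into (conductor, primitive character),
   `PrimeSums.sum_conductor_primitiveCharacter_le_divisors`) and the divisor bound
   (`Literature.NumberTheory.Sieve.exists_card_divisors_le_mul_rpow`); the `σ`-integral is
   uniform in `K` because `log K / log(K/(qH)^{7/3}) ≤ (7/3+2η)/η` (`PrimeSums.layerCake_bound`).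

The assembly is exposed as the core `lemma10_of_prop2_of_derivBounds` (profile hypothesis only at the
derivative orders the proof uses, `i ≤ ⌈7/(3η)⌉ + 3`, loss `q^{ε/4}`); `lemma10_of_prop2` is its
instantiation `ε₁ = ε/4` (statement of `lemma10` unchanged) and `lemma10'_of_prop2` (the primed
`V`-clause of `BondarenkoHeap2026Section6Weights`, loss `(q^{ε₁})^j`, rh-crit/ah E-ah-3) its
instantiation `ε₁ = ε/(4(⌈7/(3η)⌉ + 3))` (revision 2026-08-26, seat t6 g3).

Multiplicities: the explicit formula weights zeros by `DirichletDisc.zeroOrder`, and so does the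
typed count `charZeroCountRe` — they match. Everything is a THEOREM; no definition, no named fact
(gate net debt `0`; on the corpus side the leaf `lemma10` [BH-internal claim] is replaced by
`prop2` [Chen–Gupta–Li 2025, Thm 1.2]).

LABEL (rh-crit C5, LADDER-RH §4 HELD «conditional bridges: exceptional zero ⇒ …»): NOT RH-BEARING;
RH-FREE corpus literature. WHAT THIS IS NOT: any claim about `ζ`, RH, Siegel zeros or the
Alternative Hypothesis — an averaged prime-sum estimate for Dirichlet characters deduced from a
published zero-density theorem that stays a named fact. Nothing here bears on the truth of RH.

## References

* A. Bondarenko, W. Heap, arXiv:2608.07399v1 (2026), §6.5 Lemma 10 and its proof.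
  [cite: BondarenkoHeap2026, Lemma 10]
* D. R. Heath-Brown, Proc. London Math. Soc. (3) 64 (1992), Lemma 5.1 (the explicit formula used).
  [cite: HeathBrown1992PLMS, Lemma 5.1]
* H. L. Montgomery, R. C. Vaughan, *Multiplicative Number Theory I*, Thm. 10.17 (window count).
  [cite: MontgomeryVaughan2007, Theorem 10.17]
-/

noncomputable section

open Complex Real MeasureTheory Set Filter Topology intervalIntegral
open scoped ContDiff Interval ArithmeticFunction.vonMangoldt

namespace Literature.NumberTheory.LFunctions.BondarenkoHeap2026

namespace PrimeSums

/-! ### Part A: Mellin transforms of smooth weights supported in `[1, 2]` -/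

variable {V : ℝ → ℂ}

/-- A weight supported in `[1,2]` vanishes to the left of `1`. [folklore] -/
private theorem eq_zero_of_lt_one (hsupp : ∀ x : ℝ, V x ≠ 0 → 1 ≤ x ∧ x ≤ 2) {x : ℝ} (hx : x < 1) :
    V x = 0 := by
  by_contra h
  exact absurd (hsupp x h).1 (not_le.2 hx)

/-- A weight supported in `[1,2]` vanishes to the right of `2`. [folklore] -/
private theorem eq_zero_of_two_lt (hsupp : ∀ x : ℝ, V x ≠ 0 → 1 ≤ x ∧ x ≤ 2) {x : ℝ} (hx : 2 < x) :
    V x = 0 := by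
  by_contra h
  exact absurd (hsupp x h).2 (not_le.2 hx)

/-- The topological support of a weight supported in `[1,2]` lies in `[1,2]`. [folklore] -/
private theorem tsupport_subset (hsupp : ∀ x : ℝ, V x ≠ 0 → 1 ≤ x ∧ x ≤ 2) :
    tsupport V ⊆ Icc 1 2 :=
  closure_minimal (fun x hx ↦ hsupp x hx) isClosed_Icc

/-- A continuous weight supported in `[1,2]` vanishes at `1`. [folklore] -/
private theorem apply_one_eq_zero (hc : Continuous V) (hsupp : ∀ x : ℝ, V x ≠ 0 → 1 ≤ x ∧ x ≤ 2) :
    V 1 = 0 := by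
  -- `V = 0` on `(-∞, 1)`, a set with `1` in its closure
  have h1 : (1 : ℝ) ∈ closure (Iio (1 : ℝ)) := by rw [closure_Iio]; exact self_mem_Iic
  have himg : V '' Iio 1 ⊆ {0} := by
    rintro _ ⟨x, hx, rfl⟩; exact eq_zero_of_lt_one hsupp hx
  exact closure_minimal himg isClosed_singleton (hc.continuousWithinAt.mem_closure_image h1)

/-- A continuous weight supported in `[1,2]` vanishes at `2`. [folklore] -/
private theorem apply_two_eq_zero (hc : Continuous V) (hsupp : ∀ x : ℝ, V x ≠ 0 → 1 ≤ x ∧ x ≤ 2) :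
    V 2 = 0 := by
  have h2 : (2 : ℝ) ∈ closure (Ioi (2 : ℝ)) := by rw [closure_Ioi]; exact self_mem_Ici
  have himg : V '' Ioi 2 ⊆ {0} := by
    rintro _ ⟨x, hx, rfl⟩; exact eq_zero_of_two_lt hsupp hx
  exact closure_minimal himg isClosed_singleton (hc.continuousWithinAt.mem_closure_image h2)

/-- The derivative of a weight supported in `[1,2]` is supported in `[1,2]`. [folklore] -/
private theorem deriv_supp (hsupp : ∀ x : ℝ, V x ≠ 0 → 1 ≤ x ∧ x ≤ 2) :
    ∀ x : ℝ, deriv V x ≠ 0 → 1 ≤ x ∧ x ≤ 2 := fun _ hx ↦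
  tsupport_subset hsupp (support_deriv_subset (Function.mem_support.2 hx))

/-- The iterated derivatives of a weight supported in `[1,2]` are supported in `[1,2]`. [folklore] -/
private theorem iteratedDeriv_supp (hsupp : ∀ x : ℝ, V x ≠ 0 → 1 ≤ x ∧ x ≤ 2) (j : ℕ) :
    ∀ x : ℝ, iteratedDeriv j V x ≠ 0 → 1 ≤ x ∧ x ≤ 2 := by
  induction j with
  | zero => simpa using hsupp
  | succ j ih => rw [iteratedDeriv_succ]; exact deriv_supp ih

/-- The derivative of a smooth weight is smooth. [folklore] -/
private theorem contDiff_deriv (hV : ContDiff ℝ ∞ V) : ContDiff ℝ ∞ (deriv V) :=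
  (contDiff_infty_iff_deriv.1 hV).2

/-- A bounded-support continuous weight is bounded: there is `M ≥ 0` with `‖V x‖ ≤ M`. [folklore] -/
private theorem exists_bound (hc : Continuous V) (hsupp : ∀ x : ℝ, V x ≠ 0 → 1 ≤ x ∧ x ≤ 2) :
    ∃ M : ℝ, 0 ≤ M ∧ ∀ x : ℝ, ‖V x‖ ≤ M := by
  have hK : IsCompact (Icc (1 : ℝ) 2) := isCompact_Icc
  obtain ⟨M, hM⟩ := hK.exists_bound_of_continuousOn hc.continuousOn
  refine ⟨max M 0, le_max_right _ _, fun x ↦ ?_⟩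
  by_cases hx : V x = 0
  · simp [hx]
  · exact (hM x (hsupp x hx)).trans (le_max_left _ _)

/-! ### The Mellin transform as an integral over `[1, 2]` -/

/-- For a weight supported in `[1,2]`: `𝓜V(w) = ∫_1^2 x^{w−1} V(x) dx`. [cite: BondarenkoHeap2026, Lemma 10, proof (34) (Mellin transform of V)] -/
theorem mellin_eq_intervalIntegral (hc : Continuous V) (hsupp : ∀ x : ℝ, V x ≠ 0 → 1 ≤ x ∧ x ≤ 2)
    (w : ℂ) : mellin V w = ∫ x in (1 : ℝ)..2, (x : ℂ) ^ (w - 1) * V x := by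
  rw [mellin, intervalIntegral.integral_of_le (by norm_num : (1 : ℝ) ≤ 2)]
  -- the integrand vanishes off `Ioc 1 2 ⊆ Ioi 0`
  rw [← MeasureTheory.integral_indicator measurableSet_Ioc,
    ← MeasureTheory.integral_indicator measurableSet_Ioi]
  congr 1
  ext x
  simp only [indicator, mem_Ioi, mem_Ioc, smul_eq_mul]
  by_cases h1 : 1 < x
  · by_cases h2 : x ≤ 2
    · simp [h1, h2, lt_trans zero_lt_one h1]
    · simp [h2, eq_zero_of_two_lt hsupp (not_le.1 h2)]
  · push Not at h1
    rcases h1.lt_or_eq with h1 | h1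
    · simp [eq_zero_of_lt_one hsupp h1, not_lt.2 h1.le]
    · subst h1
      simp [apply_one_eq_zero hc hsupp]

/-- **Crude bound**: if `‖V‖ ≤ M` on `ℝ` then `‖𝓜V(w)‖ ≤ M · 2^{max(Re w − 1, 0)}`. [cite: BondarenkoHeap2026, Lemma 10, proof (34), j = 0] -/
theorem norm_mellin_le (hc : Continuous V) (hsupp : ∀ x : ℝ, V x ≠ 0 → 1 ≤ x ∧ x ≤ 2) {M : ℝ}
    (hM : ∀ x, ‖V x‖ ≤ M) (w : ℂ) : ‖mellin V w‖ ≤ M * (2 : ℝ) ^ max (w.re - 1) 0 := by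
  rw [mellin_eq_intervalIntegral hc hsupp]
  have key : ∀ x ∈ Ι (1 : ℝ) 2, ‖(x : ℂ) ^ (w - 1) * V x‖ ≤ (2 : ℝ) ^ max (w.re - 1) 0 * M := by
    intro x hx
    rw [uIoc_of_le (by norm_num : (1 : ℝ) ≤ 2)] at hx
    have hx0 : 0 < x := lt_trans zero_lt_one hx.1
    rw [norm_mul, Complex.norm_cpow_eq_rpow_re_of_pos hx0, sub_re, one_re]
    have hM0 : 0 ≤ M := (norm_nonneg _).trans (hM 0)
    gcongr
    calc x ^ (w.re - 1) ≤ x ^ max (w.re - 1) 0 :=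
          Real.rpow_le_rpow_of_exponent_le hx.1.le (le_max_left _ _)
      _ ≤ 2 ^ max (w.re - 1) 0 :=
          Real.rpow_le_rpow hx0.le hx.2 (le_max_right _ _)
    · exact hM x
  calc ‖∫ x in (1 : ℝ)..2, (x : ℂ) ^ (w - 1) * V x‖ ≤ (2 : ℝ) ^ max (w.re - 1) 0 * M * |2 - 1| :=
        intervalIntegral.norm_integral_le_of_norm_le_const key
    _ = M * 2 ^ max (w.re - 1) 0 := by norm_num; ring

/-! ### Integration by parts -/

/-- **One integration by parts** for a `C¹` weight supported in `[1,2]` and `w ≠ 0`: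
`𝓜V(w) = −(1/w) · 𝓜V'(w + 1)`. [cite: BondarenkoHeap2026, Lemma 10, proof (34) (one integration by parts)] -/
theorem mellin_eq_neg_mellin_deriv (hV : ContDiff ℝ ∞ V) (hsupp : ∀ x : ℝ, V x ≠ 0 → 1 ≤ x ∧ x ≤ 2)
    {w : ℂ} (hw : w ≠ 0) : mellin V w = -(1 / w) * mellin (deriv V) (w + 1) := by
  have hc : Continuous V := hV.continuous
  have hd : Differentiable ℝ V := hV.differentiable (by simp)
  have hc' : Continuous (deriv V) := (contDiff_deriv hV).continuous
  rw [mellin_eq_intervalIntegral hc hsupp, mellin_eq_intervalIntegral hc' (deriv_supp hsupp)]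
  -- by parts with `u = V`, `v = x^w / w`
  have hv : ∀ x ∈ uIcc (1 : ℝ) 2, HasDerivAt (fun y : ℝ ↦ (y : ℂ) ^ w / w) ((x : ℂ) ^ (w - 1)) x := by
    intro x hx
    rw [uIcc_of_le (by norm_num : (1 : ℝ) ≤ 2)] at hx
    have hx0 : x ≠ 0 := by linarith [hx.1]
    have := hasDerivAt_ofReal_cpow_const' hx0 (r := w - 1) (by
      intro h; apply hw; linear_combination h)
    simp only [sub_add_cancel] at this
    exact this
  have hu : ∀ x ∈ uIcc (1 : ℝ) 2, HasDerivAt V (deriv V x) x := fun x _ ↦ (hd x).hasDerivAt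
  have hcpow : ContinuousOn (fun x : ℝ ↦ (x : ℂ) ^ (w - 1)) (uIcc (1 : ℝ) 2) := by
    intro x hx
    rw [uIcc_of_le (by norm_num : (1 : ℝ) ≤ 2)] at hx
    exact (Complex.continuousAt_ofReal_cpow_const x (w - 1) (Or.inr (by linarith [hx.1]))).continuousWithinAt
  have hparts := intervalIntegral.integral_mul_deriv_eq_deriv_mul hu hv
    (hc'.intervalIntegrable _ _) (hcpow.intervalIntegrable)
  rw [apply_one_eq_zero hc hsupp, apply_two_eq_zero hc hsupp, zero_mul, zero_mul,
    sub_zero, zero_sub] at hparts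
  calc ∫ x in (1 : ℝ)..2, (x : ℂ) ^ (w - 1) * V x
      = ∫ x in (1 : ℝ)..2, V x * (x : ℂ) ^ (w - 1) := by
        congr 1; ext x; ring
    _ = -∫ x in (1 : ℝ)..2, deriv V x * ((x : ℂ) ^ w / w) := hparts
    _ = -(1 / w) * ∫ x in (1 : ℝ)..2, (x : ℂ) ^ (w + 1 - 1) * deriv V x := by
        rw [add_sub_cancel_right, neg_mul, ← intervalIntegral.integral_const_mul]
        congr 2; ext x
        field_simp

/-- **`j`-fold integration by parts**: for a smooth weight supported in `[1,2]` and `w` with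
`w + i ≠ 0` for `i < j`, `𝓜V(w) = (∏_{i<j} (−(w + i))⁻¹) · 𝓜V^{(j)}(w + j)`. [cite: BondarenkoHeap2026, Lemma 10, proof (34) (j integrations by parts)] -/
theorem mellin_eq_mellin_iteratedDeriv (hV : ContDiff ℝ ∞ V) (hsupp : ∀ x : ℝ, V x ≠ 0 → 1 ≤ x ∧ x ≤ 2)
    (j : ℕ) {w : ℂ} (hw : ∀ i : ℕ, i < j → w + i ≠ 0) :
    mellin V w = (∏ i ∈ Finset.range j, (-(w + i))⁻¹) * mellin (iteratedDeriv j V) (w + j) := by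
  induction j generalizing V w with
  | zero => simp
  | succ j ih =>
    have hw0 : w ≠ 0 := by simpa using hw 0 (Nat.succ_pos j)
    have hw' : ∀ i : ℕ, i < j → w + 1 + (i : ℂ) ≠ 0 := fun i hi ↦ by
      have := hw (i + 1) (Nat.succ_lt_succ hi)
      push_cast at this
      rwa [add_assoc, add_comm (1 : ℂ)]
    rw [mellin_eq_neg_mellin_deriv hV hsupp hw0, ih (contDiff_deriv hV) (deriv_supp hsupp) hw',
      ← iteratedDeriv_succ', Finset.prod_range_succ']
    have hprod : ∀ i ∈ Finset.range j, (-(w + 1 + (i : ℂ)))⁻¹ = (-(w + ((i + 1 : ℕ) : ℂ)))⁻¹ := by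
      intro i _; push_cast; ring
    rw [Finset.prod_congr rfl hprod]
    have h1 : w + 1 + (j : ℂ) = w + ((j + 1 : ℕ) : ℂ) := by push_cast; ring
    rw [h1]
    have h2 : -(1 / w) = (-(w + ((0 : ℕ) : ℂ)))⁻¹ := by
      rw [Nat.cast_zero, add_zero, inv_neg, one_div]
    rw [h2]
    ring

/-- **Decay of the Mellin transform**: with `‖V^{(j)}‖ ≤ M` and `w + i ≠ 0` (`i < j`),
`‖𝓜V(w)‖ ≤ M · 2^{max(Re w + j − 1, 0)} / ∏_{i<j} |w + i|`. [cite: BondarenkoHeap2026, Lemma 10, proof (34)] -/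
theorem norm_mellin_le_of_iteratedDeriv (hV : ContDiff ℝ ∞ V)
    (hsupp : ∀ x : ℝ, V x ≠ 0 → 1 ≤ x ∧ x ≤ 2) (j : ℕ) {M : ℝ}
    (hM : ∀ x, ‖iteratedDeriv j V x‖ ≤ M) {w : ℂ} (hw : ∀ i : ℕ, i < j → w + i ≠ 0) :
    ‖mellin V w‖ ≤ M * (2 : ℝ) ^ max (w.re + j - 1) 0 / ∏ i ∈ Finset.range j, ‖w + i‖ := by
  rw [mellin_eq_mellin_iteratedDeriv hV hsupp j hw, norm_mul, Complex.norm_prod]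
  have hprod : 0 < ∏ i ∈ Finset.range j, ‖w + (i : ℂ)‖ :=
    Finset.prod_pos fun i hi ↦ norm_pos_iff.2 (hw i (Finset.mem_range.1 hi))
  have hinv : ∏ i ∈ Finset.range j, ‖(-(w + (i : ℂ)))⁻¹‖ = (∏ i ∈ Finset.range j, ‖w + (i : ℂ)‖)⁻¹ := by
    rw [← Finset.prod_inv_distrib]
    exact Finset.prod_congr rfl fun i _ ↦ by rw [norm_inv, norm_neg]
  rw [hinv, inv_mul_eq_div, div_le_div_iff_of_pos_right hprod]
  have hcont : Continuous (iteratedDeriv j V) := hV.continuous_iteratedDeriv j (by exact_mod_cast le_top)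
  have := norm_mellin_le hcont (iteratedDeriv_supp hsupp j) hM (w + j)
  simpa [add_re] using this


/-! ### The Mellin transform as an integral over the line (`x = e^u`) -/

omit V in
/-- `𝓜V(w) = ∫_ℝ e^{wu} V(e^u) du` (substitution `x = e^u`). [cite: BondarenkoHeap2026, Lemma 10, proof (35) (Mellin inversion, x = e^u)] -/
theorem mellin_eq_integral_exp (V : ℝ → ℂ) (w : ℂ) :
    mellin V w = ∫ u : ℝ, cexp (w * u) * V (rexp u) := by
  have hderiv : ∀ x ∈ (univ : Set ℝ), HasDerivWithinAt rexp (rexp x) univ x :=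
    fun x _ ↦ (Real.hasDerivAt_exp x).hasDerivWithinAt
  have himage : rexp '' univ = Ioi 0 := by rw [image_univ, Real.range_exp]
  have hinj : InjOn rexp univ := Real.exp_injective.injOn
  rw [mellin, ← himage, integral_image_eq_integral_abs_deriv_smul MeasurableSet.univ hderiv hinj,
    setIntegral_univ]
  refine integral_congr_ae (Eventually.of_forall fun u ↦ ?_)
  simp only [abs_of_pos (Real.exp_pos u), smul_eq_mul]
  have hexp : ((rexp u : ℝ) : ℂ) ^ (w - 1) = cexp ((w - 1) * u) := by
    rw [Complex.ofReal_exp, cpow_def_of_ne_zero (Complex.exp_ne_zero _),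
      Complex.log_exp (by simp [pi_pos]) (by simpa using pi_nonneg), mul_comm]
  rw [hexp, Complex.real_smul, Complex.ofReal_exp, ← mul_assoc, ← Complex.exp_add]
  congr 2
  ring

/-- A continuous function vanishing on `(a, ∞)` vanishes at `a`. [folklore] -/
private theorem eq_zero_of_forall_gt {g : ℝ → ℂ} (hc : Continuous g) {a : ℝ} (h : ∀ x, a < x → g x = 0) :
    g a = 0 := by
  have ha : a ∈ closure (Ioi a) := by rw [closure_Ioi]; exact self_mem_Ici
  have himg : g '' Ioi a ⊆ {0} := by
    rintro _ ⟨x, hx, rfl⟩; exact h x hx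
  exact closure_minimal himg isClosed_singleton (hc.continuousWithinAt.mem_closure_image ha)

/-- Real version of `eq_zero_of_forall_gt`. [folklore] -/
private theorem eq_zero_of_forall_gt_real {g : ℝ → ℝ} (hc : Continuous g) {a : ℝ}
    (h : ∀ x, a < x → g x = 0) : g a = 0 := by
  have := eq_zero_of_forall_gt (g := fun x ↦ (g x : ℂ)) (a := a) (Complex.continuous_ofReal.comp hc)
    (fun x hx ↦ by simp [h x hx])
  exact_mod_cast this

/-! ### The smoothing `f_{W,K}(u) = W(e^u/K) e^{5u/4}` attached to a real weight `W` on `[1,2]` -/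

section smoothing

variable {W : ℝ → ℝ} {K : ℝ}

/-- The smoothing vanishes where `e^u/K > 2` or `e^u/K < 1`. [folklore] -/
private theorem smoothing_eq_zero_of_two_lt (hsupp : ∀ x : ℝ, W x ≠ 0 → 1 ≤ x ∧ x ≤ 2) {u : ℝ}
    (hu : 2 < rexp u / K) : W (rexp u / K) * rexp (5 / 4 * u) = 0 := by
  rw [eq_zero_of_two_lt (V := fun x ↦ (W x : ℂ)) (fun x hx ↦ hsupp x (by exact_mod_cast hx)) hu
    |> fun h ↦ (by exact_mod_cast h : W (rexp u / K) = 0), zero_mul]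

/-- The smoothing vanishes where `e^u/K < 1`. [folklore] -/
private theorem smoothing_eq_zero_of_lt_one (hsupp : ∀ x : ℝ, W x ≠ 0 → 1 ≤ x ∧ x ≤ 2) {u : ℝ}
    (hu : rexp u / K < 1) : W (rexp u / K) * rexp (5 / 4 * u) = 0 := by
  rw [eq_zero_of_lt_one (V := fun x ↦ (W x : ℂ)) (fun x hx ↦ hsupp x (by exact_mod_cast hx)) hu
    |> fun h ↦ (by exact_mod_cast h : W (rexp u / K) = 0), zero_mul]

/-- The smoothing is smooth. [folklore] -/
private theorem contDiff_smoothing (hW : ContDiff ℝ ∞ W) (K : ℝ) :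
    ContDiff ℝ ∞ (fun u : ℝ ↦ W (rexp u / K) * rexp (5 / 4 * u)) :=
  (hW.comp (Real.contDiff_exp.div_const K)).mul (Real.contDiff_exp.comp (contDiff_const.mul contDiff_id))

/-- For `K > 0` and `u ≥ log(2K)`: `e^u/K ≥ 2`. [folklore] -/
private theorem two_le_exp_div (hK : 0 < K) {u : ℝ} (hu : Real.log (2 * K) ≤ u) : 2 ≤ rexp u / K := by
  rw [le_div_iff₀ hK]
  calc 2 * K = rexp (Real.log (2 * K)) := (Real.exp_log (by positivity)).symm
    _ ≤ rexp u := Real.exp_le_exp.2 hu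

/-- The smoothing vanishes on `[log(2K), ∞)` (`K > 0`, `W` continuous). [folklore] -/
private theorem smoothing_eq_zero_of_le (hW : ContDiff ℝ ∞ W) (hsupp : ∀ x : ℝ, W x ≠ 0 → 1 ≤ x ∧ x ≤ 2)
    (hK : 0 < K) {u : ℝ} (hu : Real.log (2 * K) ≤ u) : W (rexp u / K) * rexp (5 / 4 * u) = 0 := by
  rcases (two_le_exp_div hK hu).lt_or_eq with h | h
  · exact smoothing_eq_zero_of_two_lt hsupp h
  · rw [← h]
    have h2 : ((W 2 : ℝ) : ℂ) = 0 := apply_two_eq_zero (V := fun x ↦ (W x : ℂ))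
      (Complex.continuous_ofReal.comp hW.continuous) (fun x hx ↦ hsupp x (by exact_mod_cast hx))
    rw [show W 2 = 0 by exact_mod_cast h2, zero_mul]

/-- The smoothing vanishes on `(−∞, 0]` when `K > 1`. [folklore] -/
private theorem smoothing_eq_zero_of_nonpos (hsupp : ∀ x : ℝ, W x ≠ 0 → 1 ≤ x ∧ x ≤ 2) (hK : 1 < K)
    {u : ℝ} (hu : u ≤ 0) : W (rexp u / K) * rexp (5 / 4 * u) = 0 := by
  refine smoothing_eq_zero_of_lt_one hsupp ?_
  rw [div_lt_one (by linarith)]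
  calc rexp u ≤ rexp 0 := Real.exp_le_exp.2 hu
    _ = 1 := Real.exp_zero
    _ < K := hK

/-- **The smoothing is an admissible test function** for the tree's explicit formula
(`IsSmoothedEFTest`), with `p = f`, `x₀ = log(2K)`, for `K ≥ 1/2`... here `K > 1`. [cite: BondarenkoHeap2026, Lemma 10, proof (35)] -/
theorem isSmoothedEFTest_smoothing (hW : ContDiff ℝ ∞ W) (hsupp : ∀ x : ℝ, W x ≠ 0 → 1 ≤ x ∧ x ≤ 2)
    (hK : 1 < K) :
    IsSmoothedEFTest (fun u : ℝ ↦ W (rexp u / K) * rexp (5 / 4 * u))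
      (fun u : ℝ ↦ W (rexp u / K) * rexp (5 / 4 * u))
      (deriv fun u : ℝ ↦ W (rexp u / K) * rexp (5 / 4 * u))
      (deriv (deriv fun u : ℝ ↦ W (rexp u / K) * rexp (5 / 4 * u))) (Real.log (2 * K)) := by
  set f : ℝ → ℝ := fun u ↦ W (rexp u / K) * rexp (5 / 4 * u) with hf
  have hK0 : 0 < K := by linarith
  have hfs : ContDiff ℝ ∞ f := contDiff_smoothing hW K
  have hfs' : ContDiff ℝ ∞ (deriv f) := (contDiff_infty_iff_deriv.1 hfs).2
  have hzero : ∀ u, Real.log (2 * K) ≤ u → f u = 0 := fun u hu ↦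
    smoothing_eq_zero_of_le hW hsupp hK0 hu
  -- `f'` vanishes on the open half-line `u > log(2K)`, hence at `log(2K)` by continuity
  have hderiv_zero : ∀ u, Real.log (2 * K) < u → deriv f u = 0 := by
    intro u hu
    have hev : f =ᶠ[𝓝 u] fun _ ↦ 0 := by
      filter_upwards [Ioi_mem_nhds hu] with v hv using hzero v hv.le
    rw [hev.deriv_eq, deriv_const]
  refine ⟨hfs.continuous, ?_, fun t _ ↦ rfl, hzero, fun t ↦ (hfs.differentiable (by simp) t).hasDerivAt,
    fun t ↦ (hfs'.differentiable (by simp) t).hasDerivAt, (contDiff_infty_iff_deriv.1 hfs').2.continuous,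
    hzero _ le_rfl, eq_zero_of_forall_gt_real hfs'.continuous hderiv_zero⟩
  exact Real.log_nonneg (by linarith)

/-- **The smoothed prime sum is `Σ Λ(n)χ(n)W(n/K)`**: at `s = 5/4`,
`K_{f_{W,K},χ}(5/4) = Σ_n Λ(n)χ(n)W(n/K)` (for `K > 0`). [cite: BondarenkoHeap2026, Lemma 10, proof (35) (left-hand side)] -/
theorem charFordK_smoothing {q : ℕ} (χ : DirichletCharacter ℂ q) (K : ℝ) :
    ExplicitPsiChar.charFordK χ (fun u : ℝ ↦ W (rexp u / K) * rexp (5 / 4 * u)) (5 / 4 : ℂ) =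
      ∑' n : ℕ, ((Λ n : ℝ) : ℂ) * χ n * (W (n / K) : ℂ) := by
  rw [ExplicitPsiChar.charFordK]
  refine tsum_congr fun n ↦ ?_
  rcases Nat.eq_zero_or_pos n with rfl | hn
  · simp
  have hn0 : (0 : ℝ) < n := by exact_mod_cast hn
  rw [Real.exp_log hn0]
  have h1 : rexp (5 / 4 * Real.log n) = (n : ℝ) ^ (5 / 4 : ℝ) := by
    rw [Real.rpow_def_of_pos hn0, mul_comm]
  have h2 : ((n : ℂ)) ^ (-(5 / 4 : ℂ)) = (((n : ℝ) ^ (-(5 / 4) : ℝ) : ℝ) : ℂ) := by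
    rw [Complex.ofReal_cpow hn0.le]
    push_cast
    ring_nf
  rw [h1, h2]
  have h3 : ((W (n / K) * (n : ℝ) ^ (5 / 4 : ℝ) : ℝ) : ℂ) * ((((n : ℝ) ^ (-(5 / 4) : ℝ) : ℝ)) : ℂ) =
      (W (n / K) : ℂ) := by
    rw [← Complex.ofReal_mul, mul_assoc, Real.rpow_neg hn0.le, mul_inv_cancel₀ (by positivity), mul_one]
  rw [mul_assoc (((Λ n : ℝ) : ℂ) * χ n), h3]

/-- **Laplace–Mellin identity**: for `K > 1` and every `w`,
`F_{f_{W,K}}(5/4 − w) = K^w · 𝓜W(w)`. [cite: BondarenkoHeap2026, Lemma 10, proof (35) (the weight Ṽ(s)K^s)] -/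
theorem fordLaplace_smoothing (hsupp : ∀ x : ℝ, W x ≠ 0 → 1 ≤ x ∧ x ≤ 2) (hK : 1 < K) (w : ℂ) :
    fordLaplace (fun u : ℝ ↦ W (rexp u / K) * rexp (5 / 4 * u)) ((5 / 4 : ℂ) - w) =
      (K : ℂ) ^ w * mellin (fun x ↦ (W x : ℂ)) w := by
  have hK0 : 0 < K := by linarith
  rw [fordLaplace]
  -- (i) the integrand is `e^{wu} W(e^u/K)` and vanishes for `u ≤ 0`: integrate over `ℝ`
  have hint : ∀ u : ℝ, cexp (-(((5 / 4 : ℂ) - w) * u)) * ((W (rexp u / K) * rexp (5 / 4 * u) : ℝ) : ℂ) =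
      cexp (w * u) * (W (rexp u / K) : ℂ) := by
    intro u
    push_cast
    rw [mul_left_comm, ← Complex.exp_add, mul_comm]
    congr 2
    ring
  simp_rw [hint]
  rw [setIntegral_eq_integral_of_forall_compl_eq_zero (fun u hu ↦ by
    rw [mem_Ioi, not_lt] at hu
    have := smoothing_eq_zero_of_nonpos hsupp hK hu
    have hW0 : W (rexp u / K) = 0 := by
      rcases mul_eq_zero.1 this with h | h
      · exact h
      · exact absurd h (Real.exp_pos _).ne'
    simp [hW0])]
  -- (ii) substitute `u = t + log K`
  have hKw : cexp (w * (Real.log K : ℂ)) = (K : ℂ) ^ w := by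
    rw [cpow_def_of_ne_zero (by exact_mod_cast hK0.ne'), Complex.ofReal_log hK0.le, mul_comm]
  rw [← integral_add_right_eq_self _ (Real.log K), mellin_eq_integral_exp,
    ← MeasureTheory.integral_const_mul]
  refine integral_congr_ae (Eventually.of_forall fun t ↦ ?_)
  simp only
  rw [Real.exp_add, Real.exp_log hK0, mul_div_cancel_right₀ _ hK0.ne']
  push_cast
  rw [mul_add, Complex.exp_add, hKw]
  ring

end smoothing


/-! ### Part C: the zero-side bound for one primitive character -/

section perCharacter

open ExplicitPsiChar

variable {d : ℕ} [NeZero d] {ξ : DirichletCharacter ℂ d} {W : ℝ → ℝ} {K : ℝ}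

/-- `f_{W,K}(0) = 0` for `K > 1`. [folklore] -/
private theorem smoothing_zero (hsupp : ∀ x : ℝ, W x ≠ 0 → 1 ≤ x ∧ x ≤ 2) (hK : 1 < K) :
    (fun u : ℝ ↦ W (rexp u / K) * rexp (5 / 4 * u)) 0 = 0 :=
  smoothing_eq_zero_of_nonpos hsupp hK le_rfl

/-- `F₀ = F` for the smoothing (`f(0) = 0`). [cite: BondarenkoHeap2026, Lemma 10, proof (35)] -/
theorem fordLaplace₀_smoothing (hsupp : ∀ x : ℝ, W x ≠ 0 → 1 ≤ x ∧ x ≤ 2) (hK : 1 < K) (z : ℂ) :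
    fordLaplace₀ (fun u : ℝ ↦ W (rexp u / K) * rexp (5 / 4 * u)) z =
      fordLaplace (fun u : ℝ ↦ W (rexp u / K) * rexp (5 / 4 * u)) z := by
  have h0 : W (rexp 0 / K) * rexp (5 / 4 * 0) = 0 := smoothing_zero hsupp hK
  rw [fordLaplace₀, h0, Complex.ofReal_zero, zero_div, sub_zero]

/-- `‖F(5/4 − w)‖ = K^{Re w} ‖𝓜W(w)‖`. [cite: BondarenkoHeap2026, Lemma 10, proof (35) (|K^ρ| = K^β)] -/
theorem norm_fordLaplace_smoothing (hsupp : ∀ x : ℝ, W x ≠ 0 → 1 ≤ x ∧ x ≤ 2) (hK : 1 < K) (w : ℂ) :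
    ‖fordLaplace (fun u : ℝ ↦ W (rexp u / K) * rexp (5 / 4 * u)) ((5 / 4 : ℂ) - w)‖ =
      K ^ w.re * ‖mellin (fun x ↦ (W x : ℂ)) w‖ := by
  rw [fordLaplace_smoothing hsupp hK, norm_mul, Complex.norm_cpow_eq_rpow_re_of_pos (by linarith)]

/-- `1/|γ|^j ≤ 2 / (H^{j−2} (1 + γ²))` for `|γ| > H ≥ 1`, `j ≥ 2`. [folklore] -/
private theorem inv_pow_le_of_lt {γ H : ℝ} (hH : 1 ≤ H) (hγ : H < |γ|) {j : ℕ} (hj : 2 ≤ j) :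
    (|γ| ^ j)⁻¹ ≤ 2 / (H ^ (j - 2) * (1 + γ ^ 2)) := by
  have hγ1 : 1 < |γ| := lt_of_le_of_lt hH hγ
  have hγ0 : 0 < |γ| := lt_trans zero_lt_one hγ1
  have hH0 : 0 < H := lt_of_lt_of_le zero_lt_one hH
  obtain ⟨k, rfl⟩ := Nat.exists_eq_add_of_le hj
  rw [Nat.add_sub_cancel_left, inv_eq_one_div, div_le_div_iff₀ (by positivity) (by positivity), one_mul,
    pow_add]
  have h1 : H ^ k ≤ |γ| ^ k := pow_le_pow_left₀ hH0.le hγ.le k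
  have hγ2 : 1 < γ ^ 2 := by
    rw [← sq_abs]; exact one_lt_pow₀ hγ1 two_ne_zero
  have h2 : 1 + γ ^ 2 ≤ 2 * |γ| ^ 2 := by rw [sq_abs]; linarith
  calc H ^ k * (1 + γ ^ 2) ≤ |γ| ^ k * (2 * |γ| ^ 2) := by gcongr
    _ = 2 * (|γ| ^ 2 * |γ| ^ k) := by ring

/-- For a non-trivial zero `ρ` (`0 < Re ρ < 1`) and `w = ρ`: `∏_{i<j} ‖ρ + i‖ ≥ |Im ρ|^j`. [folklore] -/
private theorem abs_im_pow_le_prod (ρ : ℂ) (j : ℕ) :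
    |ρ.im| ^ j ≤ ∏ i ∈ Finset.range j, ‖ρ + (i : ℂ)‖ := by
  have h : |ρ.im| ^ j = ∏ _i ∈ Finset.range j, |ρ.im| := by
    rw [Finset.prod_const, Finset.card_range]
  rw [h]
  refine Finset.prod_le_prod (fun _ _ ↦ abs_nonneg _) fun i _ ↦ ?_
  have := Complex.abs_im_le_norm (ρ + (i : ℂ))
  simpa using this

/-- **Far zeros**: for `|Im ρ| > H ≥ 1`, `0 < Re ρ < 1`, `K > 1`, `j ≥ 2`, `‖W^{(j)}‖ ≤ Mj`:
`‖F(5/4 − ρ)‖ ≤ K · (2^{j+1} Mj / H^{j−2}) / (1 + (Im ρ)²)`. [cite: BondarenkoHeap2026, Lemma 10, proof (zeros with |γ| > H, TeX l.1217–1228)] -/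
theorem norm_fordLaplace_smoothing_le_far (hWc : ContDiff ℝ ∞ fun x ↦ (W x : ℂ))
    (hsupp : ∀ x : ℝ, W x ≠ 0 → 1 ≤ x ∧ x ≤ 2) (hK : 1 < K) {H : ℝ} (hH : 1 ≤ H) {j : ℕ} (hj : 2 ≤ j)
    {Mj : ℝ} (hMj : ∀ x, ‖iteratedDeriv j (fun x ↦ (W x : ℂ)) x‖ ≤ Mj)
    {ρ : ℂ} (h0 : 0 < ρ.re) (h1 : ρ.re < 1) (hγ : H < |ρ.im|) :
    ‖fordLaplace (fun u : ℝ ↦ W (rexp u / K) * rexp (5 / 4 * u)) ((5 / 4 : ℂ) - ρ)‖ ≤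
      K * (2 ^ (j + 1) * Mj / H ^ (j - 2)) / (1 + ρ.im ^ 2) := by
  have hsuppc : ∀ x : ℝ, (fun x ↦ (W x : ℂ)) x ≠ 0 → 1 ≤ x ∧ x ≤ 2 :=
    fun x hx ↦ hsupp x (by simpa using hx)
  have hMj0 : 0 ≤ Mj := (norm_nonneg _).trans (hMj 0)
  have hγ0 : 0 < |ρ.im| := lt_of_le_of_lt (le_trans zero_le_one hH) hγ
  have hH0 : 0 < H := lt_of_lt_of_le zero_lt_one hH
  have hw : ∀ i : ℕ, i < j → ρ + i ≠ 0 := by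
    intro i _ h
    have := congrArg Complex.im h
    simp at this
    exact hγ0.ne' (by rw [this, abs_zero])
  rw [norm_fordLaplace_smoothing hsupp hK]
  have hKβ : K ^ ρ.re ≤ K := by
    conv_rhs => rw [← Real.rpow_one K]
    exact Real.rpow_le_rpow_of_exponent_le hK.le h1.le
  have hmel := norm_mellin_le_of_iteratedDeriv hWc hsuppc j hMj hw
  have h2j : (2 : ℝ) ^ max (ρ.re + j - 1) 0 ≤ 2 ^ j := by
    calc (2 : ℝ) ^ max (ρ.re + j - 1) 0 ≤ (2 : ℝ) ^ (j : ℝ) :=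
          Real.rpow_le_rpow_of_exponent_le one_le_two (max_le (by linarith) (by positivity))
      _ = 2 ^ j := Real.rpow_natCast 2 j
  have hprod := abs_im_pow_le_prod ρ j
  have hprod0 : 0 < |ρ.im| ^ j := pow_pos hγ0 j
  calc K ^ ρ.re * ‖mellin (fun x ↦ (W x : ℂ)) ρ‖
      ≤ K * (Mj * 2 ^ j / |ρ.im| ^ j) := by
        refine mul_le_mul hKβ (hmel.trans ?_) (norm_nonneg _) (by linarith)
        rw [div_le_div_iff₀ (lt_of_lt_of_le hprod0 hprod) hprod0]
        calc Mj * 2 ^ max (ρ.re + ↑j - 1) 0 * |ρ.im| ^ j ≤ Mj * 2 ^ j * |ρ.im| ^ j := by gcongr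
          _ ≤ Mj * 2 ^ j * ∏ i ∈ Finset.range j, ‖ρ + (i : ℂ)‖ := by gcongr
    _ = K * (Mj * 2 ^ j) * (|ρ.im| ^ j)⁻¹ := by ring
    _ ≤ K * (Mj * 2 ^ j) * (2 / (H ^ (j - 2) * (1 + ρ.im ^ 2))) := by
        refine mul_le_mul_of_nonneg_left (inv_pow_le_of_lt hH hγ hj) (by positivity)
    _ = K * (2 ^ (j + 1) * Mj / H ^ (j - 2)) / (1 + ρ.im ^ 2) := by
        rw [pow_succ]
        field_simp
        ring

/-- **Near zeros**: for `0 < Re ρ < 1`, `K > 1`, `‖W‖ ≤ M0`: `‖F(5/4 − ρ)‖ ≤ K^{Re ρ} M0`. [cite: BondarenkoHeap2026, Lemma 10, proof (zeros with |γ| ≤ H, TeX l.1230–1242)] -/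
theorem norm_fordLaplace_smoothing_le_near (hc : Continuous fun x ↦ (W x : ℂ))
    (hsupp : ∀ x : ℝ, W x ≠ 0 → 1 ≤ x ∧ x ≤ 2) (hK : 1 < K)
    {M0 : ℝ} (hM0 : ∀ x, ‖(W x : ℂ)‖ ≤ M0) {w : ℂ} (h1 : w.re ≤ 1) :
    ‖fordLaplace (fun u : ℝ ↦ W (rexp u / K) * rexp (5 / 4 * u)) ((5 / 4 : ℂ) - w)‖ ≤
      K ^ w.re * M0 := by
  have hsuppc : ∀ x : ℝ, (fun x ↦ (W x : ℂ)) x ≠ 0 → 1 ≤ x ∧ x ≤ 2 :=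
    fun x hx ↦ hsupp x (by simpa using hx)
  rw [norm_fordLaplace_smoothing hsupp hK]
  refine mul_le_mul_of_nonneg_left ?_ (Real.rpow_nonneg (by linarith) _)
  have := norm_mellin_le hc hsuppc hM0 w
  rwa [max_eq_right (by linarith), Real.rpow_zero, mul_one] at this


/-- On the left line `Re w = −5/2`: `‖F₀(5/4 − w)‖ ≤ (25/4) M2 / ((15/4)² + y²)`. [cite: BondarenkoHeap2026, Lemma 10, proof (the new vertical integral, TeX l.1176–1181)] -/
theorem norm_fordLaplace₀_smoothing_leftLine (hWc : ContDiff ℝ ∞ fun x ↦ (W x : ℂ))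
    (hsupp : ∀ x : ℝ, W x ≠ 0 → 1 ≤ x ∧ x ≤ 2) (hK : 1 < K)
    {M2 : ℝ} (hM2 : ∀ x, ‖iteratedDeriv 2 (fun x ↦ (W x : ℂ)) x‖ ≤ M2) (y : ℝ) :
    ‖fordLaplace₀ (fun u : ℝ ↦ W (rexp u / K) * rexp (5 / 4 * u))
        ((5 / 4 : ℂ) - ((((-(5 / 2) : ℝ)) : ℂ) + y * I))‖ ≤
      25 / 4 * M2 / (((5 / 4 : ℂ).re + 5 / 2) ^ 2 + ((5 / 4 : ℂ).im - y) ^ 2) := by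
  have hsuppc : ∀ x : ℝ, (fun x ↦ (W x : ℂ)) x ≠ 0 → 1 ≤ x ∧ x ≤ 2 :=
    fun x hx ↦ hsupp x (by simpa using hx)
  have hM20 : 0 ≤ M2 := (norm_nonneg _).trans (hM2 0)
  set w : ℂ := (((-(5 / 2) : ℝ)) : ℂ) + y * I with hw
  have hwre : w.re = -(5 / 2) := by simp [hw]
  have hwim : w.im = y := by simp [hw]
  have hw0 : ∀ i : ℕ, i < 2 → w + i ≠ 0 := by
    intro i hi h
    have := congrArg Complex.re h
    simp [hw] at this
    interval_cases i <;> norm_num at this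
  rw [fordLaplace₀_smoothing hsupp hK, norm_fordLaplace_smoothing hsupp hK, hwre]
  have hK52 : K ^ (-(5 / 2) : ℝ) ≤ 1 := Real.rpow_le_one_of_one_le_of_nonpos hK.le (by norm_num)
  have hmel := norm_mellin_le_of_iteratedDeriv hWc hsuppc 2 hM2 hw0
  rw [Finset.prod_range_succ, Finset.prod_range_one, Nat.cast_zero, add_zero, Nat.cast_one, hwre,
    show max (-(5 / 2) + ((2 : ℕ) : ℝ) - 1) 0 = (0 : ℝ) by norm_num, Real.rpow_zero, mul_one] at hmel
  -- `‖w‖ ‖w+1‖ ≥ 9/4 + y²` and `(25/4)(9/4 + y²) ≥ (15/4)² + y²`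
  have hn1 : (9 / 4 : ℝ) + y ^ 2 ≤ ‖w + 1‖ ^ 2 := by
    rw [Complex.sq_norm, Complex.normSq_apply]; simp [hw]; nlinarith
  have hn0 : ‖w + 1‖ ≤ ‖w‖ := by
    rw [← sq_le_sq₀ (norm_nonneg _) (norm_nonneg _), Complex.sq_norm, Complex.sq_norm,
      Complex.normSq_apply, Complex.normSq_apply]
    simp [hw]; nlinarith
  have hpos : 0 < (9 / 4 : ℝ) + y ^ 2 := by positivity
  have hprod : (9 / 4 : ℝ) + y ^ 2 ≤ ‖w‖ * ‖w + 1‖ := by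
    calc (9 / 4 : ℝ) + y ^ 2 ≤ ‖w + 1‖ ^ 2 := hn1
      _ = ‖w + 1‖ * ‖w + 1‖ := sq _
      _ ≤ ‖w‖ * ‖w + 1‖ := mul_le_mul_of_nonneg_right hn0 (norm_nonneg _)
  simp only [show (5 / 4 : ℂ).re = 5 / 4 by norm_num, show (5 / 4 : ℂ).im = 0 by norm_num, zero_sub,
    even_two, Even.neg_pow]
  calc K ^ (-(5 / 2) : ℝ) * ‖mellin (fun x ↦ (W x : ℂ)) w‖ ≤ 1 * (M2 / (‖w‖ * ‖w + 1‖)) := by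
        gcongr
      _ ≤ M2 / (9 / 4 + y ^ 2) := by
        rw [one_mul]; exact div_le_div_of_nonneg_left hM20 hpos hprod
      _ ≤ 25 / 4 * M2 / ((5 / 4 + 5 / 2) ^ 2 + y ^ 2) := by
        rw [div_le_div_iff₀ hpos (by positivity)]
        nlinarith

/-- **The zero side for one primitive character.** For `ξ` primitive mod `d > 1`, a real smooth
weight `W` supported in `[1,2]` with `‖W‖ ≤ M0`, `‖W^{(j)}‖ ≤ Mj` (`j ≥ 2`), `K > 1`, `H ≥ 1`, and
`T ≥ Σ_ρ m(ρ)/(1+γ²)`: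
`‖Σ_n Λ(n)ξ(n)W(n/K)‖ ≤ K·(2^{j+1}Mj/H^{j−2})·T + K^{1/2}·M0·(1+H²)·T + K·M0·S₃ + 2M0 + ‖J_ξ(5/4)‖`,
where `S₃ = Σ_{|γ|≤H, β>1/2} m(ρ)K^{β−1}` and `J_ξ` is the left-line remainder of the explicit
formula `ExplicitPsiChar.charFordK_eq_explicit` for the smoothing `f_{W,K}`. This is Bondarenko–Heap's
(35) summed over the three ranges of zeros (TeX l.1176–1242), with the tree's window bound in place of
(36). [cite: BondarenkoHeap2026, Lemma 10, proof, (35)] -/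
theorem norm_tsum_vonMangoldt_mul_le (hprim : ξ.IsPrimitive) (hd : 1 < d)
    (hW : ContDiff ℝ ∞ W) (hWc : ContDiff ℝ ∞ fun x ↦ (W x : ℂ))
    (hsupp : ∀ x : ℝ, W x ≠ 0 → 1 ≤ x ∧ x ≤ 2) (hK : 1 < K) {H : ℝ} (hH : 1 ≤ H) {j : ℕ} (hj : 2 ≤ j)
    {M0 Mj : ℝ} (hM0 : ∀ x, ‖(W x : ℂ)‖ ≤ M0)
    (hMj : ∀ x, ‖iteratedDeriv j (fun x ↦ (W x : ℂ)) x‖ ≤ Mj) {T : ℝ}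
    (hTs : Summable fun ρ : charNontrivialZeros ξ ↦
      (DirichletDisc.zeroOrder ξ (ρ : ℂ) : ℝ) / (1 + (ρ : ℂ).im ^ 2))
    (hT : ∑' ρ : charNontrivialZeros ξ,
      (DirichletDisc.zeroOrder ξ (ρ : ℂ) : ℝ) / (1 + (ρ : ℂ).im ^ 2) ≤ T) :
    ‖∑' n : ℕ, ((Λ n : ℝ) : ℂ) * ξ n * (W (n / K) : ℂ)‖ ≤
      K * (2 ^ (j + 1) * Mj / H ^ (j - 2)) * T + K ^ (1 / 2 : ℝ) * M0 * (1 + H ^ 2) * T +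
        K * M0 * (∑ z ∈ (lfunctionZeroBox_finite (ExplicitPsiChar.ne_one_of_isPrimitive hprim hd) H).toFinset,
          if 1 / 2 < z.re then (DirichletDisc.zeroOrder ξ z : ℝ) * K ^ (z.re - 1) else 0) +
        2 * M0 + ‖charEFRemainder ξ (fun u : ℝ ↦ W (rexp u / K) * rexp (5 / 4 * u)) (5 / 4 : ℂ)‖ := by
  classical
  have hξ1 : ξ ≠ 1 := ExplicitPsiChar.ne_one_of_isPrimitive hprim hd
  have hc : Continuous fun x ↦ (W x : ℂ) := hWc.continuous
  have hK0 : 0 < K := by linarith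
  have hM00 : 0 ≤ M0 := (norm_nonneg _).trans (hM0 0)
  have hMj0 : 0 ≤ Mj := (norm_nonneg _).trans (hMj 0)
  have hT0 : 0 ≤ T := le_trans (tsum_nonneg fun ρ ↦ by positivity) hT
  have htest := isSmoothedEFTest_smoothing hW hsupp hK
  have hLs : ξ.LFunction (5 / 4 : ℂ) ≠ 0 :=
    DirichletCharacter.LFunction_ne_zero_of_one_le_re ξ (Or.inl hξ1) (by norm_num)
  have hEF := charFordK_eq_explicit hprim hd htest (s := (5 / 4 : ℂ)) (by norm_num) (by norm_num) hLs
  have hsum := summable_norm_charZeroTerm hprim hd htest (s := (5 / 4 : ℂ)) (by norm_num) hLs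
  have hf0 : W (rexp 0 / K) * rexp (5 / 4 * 0) = 0 := smoothing_zero hsupp hK
  rw [← charFordK_smoothing ξ K, hEF, hf0]
  simp only [Complex.ofReal_zero, neg_zero, zero_mul, zero_sub]
  set f : ℝ → ℝ := fun u ↦ W (rexp u / K) * rexp (5 / 4 * u) with hf
  have hF₀ : ∀ z : ℂ, fordLaplace₀ f z = fordLaplace f z := fun z ↦ by
    rw [hf]; exact fordLaplace₀_smoothing hsupp hK z
  have hnear : ∀ w : ℂ, w.re ≤ 1 → ‖fordLaplace f ((5 / 4 : ℂ) - w)‖ ≤ K ^ w.re * M0 := fun w hw ↦ by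
    rw [hf]; exact norm_fordLaplace_smoothing_le_near hc hsupp hK hM0 hw
  have hfar : ∀ ρ : ℂ, 0 < ρ.re → ρ.re < 1 → H < |ρ.im| →
      ‖fordLaplace f ((5 / 4 : ℂ) - ρ)‖ ≤ K * (2 ^ (j + 1) * Mj / H ^ (j - 2)) / (1 + ρ.im ^ 2) :=
    fun ρ h0 h1 hγ ↦ by rw [hf]; exact norm_fordLaplace_smoothing_le_far hWc hsupp hK hH hj hMj h0 h1 hγ
  set m : ℂ → ℕ := DirichletDisc.zeroOrder ξ with hm
  set S := ∑' ρ : charNontrivialZeros ξ, (m (ρ : ℂ) : ℂ) * fordLaplace₀ f ((5 / 4 : ℂ) - ρ) with hS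
  set Striv := ∑ τ ∈ charTrivialZeroFinset hξ1, (m τ : ℂ) * fordLaplace₀ f ((5 / 4 : ℂ) - τ) with hStriv
  set J := charEFRemainder ξ f (5 / 4 : ℂ) with hJ
  -- (1) the trivial zeros
  have hF0 : ∀ w : ℂ, w.re ≤ 0 → ‖fordLaplace₀ f ((5 / 4 : ℂ) - w)‖ ≤ M0 := by
    intro w hw
    rw [hF₀]
    refine (hnear w (by linarith)).trans ?_
    calc K ^ w.re * M0 ≤ 1 * M0 := by
          gcongr; exact Real.rpow_le_one_of_one_le_of_nonpos hK.le hw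
      _ = M0 := one_mul _
  have htriv : ‖Striv‖ ≤ 2 * M0 := by
    refine norm_sum_trivial_le hprim hd hM00 ?_ ?_ ?_
    · simpa using hF0 0 le_rfl
    · have := hF0 (-1) (by norm_num); rwa [sub_neg_eq_add] at this
    · have := hF0 (-2) (by norm_num); rwa [sub_neg_eq_add] at this
  -- (2) the non-trivial zeros: `‖S‖ ≤ Σ' g`
  set g : charNontrivialZeros ξ → ℝ := fun ρ ↦ ‖(m (ρ : ℂ) : ℂ) * fordLaplace₀ f ((5 / 4 : ℂ) - ρ)‖ with hg
  have hgsum : Summable g := hsum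
  have hSle : ‖S‖ ≤ ∑' ρ, g ρ := norm_tsum_le_tsum_norm hsum
  have hgval : ∀ ρ : charNontrivialZeros ξ, g ρ = (m (ρ : ℂ) : ℝ) * ‖fordLaplace f ((5 / 4 : ℂ) - ρ)‖ := by
    intro ρ
    simp only [hg, norm_mul, Complex.norm_natCast, hF₀]
  -- split at `|γ| ≤ H`
  set SH := charZeroFinset hξ1 H with hSH
  have hsplit := hgsum.sum_add_tsum_compl (s := SH)
  -- (2a) the tail `|γ| > H`
  set c₁ : ℝ := K * (2 ^ (j + 1) * Mj / H ^ (j - 2)) with hc₁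
  have hc₁0 : 0 ≤ c₁ := by positivity
  set A : charNontrivialZeros ξ → ℝ := fun ρ ↦ c₁ * ((m (ρ : ℂ) : ℝ) / (1 + (ρ : ℂ).im ^ 2)) with hA
  have hAsum : Summable A := hTs.mul_left c₁
  have hA0 : ∀ ρ, 0 ≤ A ρ := fun ρ ↦ by positivity
  have htail : ∑' ρ : ↑((SH : Set (charNontrivialZeros ξ))ᶜ), g ρ ≤ c₁ * T := by
    have h1 : ∀ ρ : ↑((SH : Set (charNontrivialZeros ξ))ᶜ), g ρ ≤ A ρ := by
      intro ρ
      have hρS : H < |((ρ : charNontrivialZeros ξ) : ℂ).im| := by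
        by_contra hle
        exact ρ.2 (Finset.mem_coe.2 (mem_charZeroFinset.2 (not_lt.1 hle)))
      have hρ := (ρ : charNontrivialZeros ξ).2
      rw [hgval, hA]
      have hfar := hfar _ hρ.2.1 hρ.2.2 hρS
      have hm0 : (0 : ℝ) ≤ m ((ρ : charNontrivialZeros ξ) : ℂ) := Nat.cast_nonneg _
      calc (m ((ρ : charNontrivialZeros ξ) : ℂ) : ℝ) * ‖fordLaplace f (5 / 4 - ↑↑ρ)‖
          ≤ (m ((ρ : charNontrivialZeros ξ) : ℂ) : ℝ) * (c₁ / (1 + ((ρ : charNontrivialZeros ξ) : ℂ).im ^ 2)) :=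
            mul_le_mul_of_nonneg_left hfar hm0
        _ = c₁ * ((m ((ρ : charNontrivialZeros ξ) : ℂ) : ℝ) / (1 + ((ρ : charNontrivialZeros ξ) : ℂ).im ^ 2)) := by
            ring
    calc ∑' ρ : ↑((SH : Set (charNontrivialZeros ξ))ᶜ), g ρ
        ≤ ∑' ρ : ↑((SH : Set (charNontrivialZeros ξ))ᶜ), A ρ :=
          Summable.tsum_le_tsum h1 (hgsum.subtype _) (hAsum.subtype _)
      _ ≤ ∑' ρ, A ρ := hAsum.tsum_subtype_le A _ hA0
      _ = c₁ * ∑' ρ : charNontrivialZeros ξ, ((m (ρ : ℂ) : ℝ) / (1 + (ρ : ℂ).im ^ 2)) := tsum_mul_left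
      _ ≤ c₁ * T := mul_le_mul_of_nonneg_left hT hc₁0
  -- (2b) the zeros with `|γ| ≤ H`
  set S3 : ℝ := ∑ z ∈ (lfunctionZeroBox_finite hξ1 H).toFinset,
      if 1 / 2 < z.re then (m z : ℝ) * K ^ (z.re - 1) else 0 with hS3
  have hfin : ∑ ρ ∈ SH, g ρ ≤ K ^ (1 / 2 : ℝ) * M0 * (1 + H ^ 2) * T + K * M0 * S3 := by
    have hpt : ∀ ρ ∈ SH, g ρ ≤ K ^ (1 / 2 : ℝ) * M0 * ((1 + H ^ 2) * ((m (ρ : ℂ) : ℝ) / (1 + (ρ : ℂ).im ^ 2))) +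
        K * M0 * (if 1 / 2 < (ρ : ℂ).re then (m (ρ : ℂ) : ℝ) * K ^ ((ρ : ℂ).re - 1) else 0) := by
      intro ρ hρ
      rw [mem_charZeroFinset] at hρ
      have hρ' := ρ.2
      have hm0 : (0 : ℝ) ≤ m (ρ : ℂ) := Nat.cast_nonneg _
      have hnear := hnear (ρ : ℂ) hρ'.2.2.le
      rw [hgval]
      -- `m ≤ (1+H²) m/(1+γ²)`
      have hcount : (m (ρ : ℂ) : ℝ) ≤ (1 + H ^ 2) * ((m (ρ : ℂ) : ℝ) / (1 + (ρ : ℂ).im ^ 2)) := by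
        rw [mul_div_assoc', le_div_iff₀ (by positivity)]
        have : (ρ : ℂ).im ^ 2 ≤ H ^ 2 := by
          rw [← sq_abs]; exact pow_le_pow_left₀ (abs_nonneg _) hρ 2
        nlinarith
      by_cases hβ : 1 / 2 < (ρ : ℂ).re
      · rw [if_pos hβ]
        have hKβ : K ^ (ρ : ℂ).re = K * K ^ ((ρ : ℂ).re - 1) := by
          rw [Real.rpow_sub hK0, Real.rpow_one]; field_simp
        calc (m (ρ : ℂ) : ℝ) * ‖fordLaplace f (5 / 4 - ↑ρ)‖ ≤ (m (ρ : ℂ) : ℝ) * (K ^ (ρ : ℂ).re * M0) :=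
              mul_le_mul_of_nonneg_left hnear hm0
          _ = 0 + K * M0 * ((m (ρ : ℂ) : ℝ) * K ^ ((ρ : ℂ).re - 1)) := by rw [hKβ]; ring
          _ ≤ _ := add_le_add (by positivity) le_rfl
      · rw [if_neg hβ]
        push Not at hβ
        have hKβ : K ^ (ρ : ℂ).re ≤ K ^ (1 / 2 : ℝ) := Real.rpow_le_rpow_of_exponent_le hK.le hβ
        calc (m (ρ : ℂ) : ℝ) * ‖fordLaplace f (5 / 4 - ↑ρ)‖ ≤ (m (ρ : ℂ) : ℝ) * (K ^ (1 / 2 : ℝ) * M0) :=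
              mul_le_mul_of_nonneg_left (hnear.trans (by gcongr)) hm0
          _ = K ^ (1 / 2 : ℝ) * M0 * (m (ρ : ℂ) : ℝ) + K * M0 * 0 := by ring
          _ ≤ _ := add_le_add (mul_le_mul_of_nonneg_left hcount (by positivity)) le_rfl
    refine (Finset.sum_le_sum hpt).trans ?_
    rw [Finset.sum_add_distrib, ← Finset.mul_sum, ← Finset.mul_sum, ← Finset.mul_sum]
    have hwin : ∑ ρ ∈ SH, (m (ρ : ℂ) : ℝ) / (1 + (ρ : ℂ).im ^ 2) ≤ T :=
      (hTs.sum_le_tsum SH fun ρ _ ↦ by positivity).trans hT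
    have hS3' : ∑ ρ ∈ SH, (if 1 / 2 < (ρ : ℂ).re then (m (ρ : ℂ) : ℝ) * K ^ ((ρ : ℂ).re - 1) else 0) = S3 :=
      sum_charZeroFinset_eq hξ1 H
        (fun z : ℂ ↦ if 1 / 2 < z.re then (m z : ℝ) * K ^ (z.re - 1) else 0)
    rw [hS3']
    have h1 : K ^ (1 / 2 : ℝ) * M0 * ((1 + H ^ 2) * ∑ ρ ∈ SH, (m (ρ : ℂ) : ℝ) / (1 + (ρ : ℂ).im ^ 2)) ≤
        K ^ (1 / 2 : ℝ) * M0 * ((1 + H ^ 2) * T) :=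
      mul_le_mul_of_nonneg_left (mul_le_mul_of_nonneg_left hwin (by positivity)) (by positivity)
    linarith
  -- (3) assemble
  have hStot : ‖S‖ ≤ c₁ * T + (K ^ (1 / 2 : ℝ) * M0 * (1 + H ^ 2) * T + K * M0 * S3) := by
    refine hSle.trans ?_
    rw [← hsplit]
    linarith [hfin, htail]
  calc ‖-S - Striv + J‖ ≤ ‖-S - Striv‖ + ‖J‖ := norm_add_le _ _
    _ ≤ ‖S‖ + ‖Striv‖ + ‖J‖ := by gcongr; rw [← norm_neg S]; exact norm_sub_le _ _
    _ ≤ _ := by rw [hc₁] at hStot; linarith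

end perCharacter

/-! ### Part D: real and imaginary parts, the imprimitive correction, aggregation, layer cake -/

section aggregate

/-- Iterated derivatives commute with a real-linear map `ℂ → ℂ` (used for `Re`, `Im`). [folklore] -/
private theorem iteratedDeriv_clm_comp (L : ℂ →L[ℝ] ℂ) {V : ℝ → ℂ} (hV : ContDiff ℝ ∞ V) (i : ℕ) :
    iteratedDeriv i (fun x ↦ L (V x)) = fun x ↦ L (iteratedDeriv i V x) := by
  induction i with
  | zero => simp
  | succ i ih =>
    rw [iteratedDeriv_succ, ih, iteratedDeriv_succ]
    funext x
    have hd : DifferentiableAt ℝ (iteratedDeriv i V) x :=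
      (hV.differentiable_iteratedDeriv i (WithTop.coe_lt_coe.2 (ENat.coe_lt_top i))) x
    exact (L.hasFDerivAt.comp_hasDerivAt x hd.hasDerivAt).deriv

/-- For `L = Re` or `Im` (followed by `ofReal`): `‖(W^{(i)})‖ ≤ ‖V^{(i)}‖` pointwise when `‖L z‖ ≤ ‖z‖`.
[folklore] -/
private theorem norm_iteratedDeriv_clm_comp_le (L : ℂ →L[ℝ] ℂ) (hL : ∀ z, ‖L z‖ ≤ ‖z‖) {V : ℝ → ℂ}
    (hV : ContDiff ℝ ∞ V) (i : ℕ) (x : ℝ) :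
    ‖iteratedDeriv i (fun x ↦ L (V x)) x‖ ≤ ‖iteratedDeriv i V x‖ := by
  rw [iteratedDeriv_clm_comp L hV i]
  exact hL _

/-- **The imprimitive correction** (TeX l.1126–1150): for `ψ` mod `q` inducing `ψ⋆`, a weight `V`
supported in `[1,2]` with `‖V‖ ≤ M0`, and `K ≥ 1`,
`‖Σ_{n≤2K} Λ(n)ψ(n)V(n/K) − Σ_n Λ(n)ψ⋆(n)V(n/K)‖ ≤ M0 · ω(q)(log₂⌊2K⌋+1) log q`
(the two sums differ only at the prime powers of the primes dividing `q`).
[cite: BondarenkoHeap2026, Lemma 10, proof (reduction to primitive characters)] -/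
theorem norm_sum_sub_tsum_primitive_le {q : ℕ} [NeZero q] (ψ : DirichletCharacter ℂ q)
    {V : ℝ → ℂ} (hsupp : ∀ x : ℝ, V x ≠ 0 → 1 ≤ x ∧ x ≤ 2) {M0 : ℝ} (hM0 : ∀ x, ‖V x‖ ≤ M0)
    {K : ℝ} (hK : 1 ≤ K) :
    ‖∑ n ∈ Finset.Icc 1 ⌊2 * K⌋₊, ((Λ n : ℝ) : ℂ) * ψ (n : ZMod q) * V ((n : ℝ) / K) -
        ∑' n : ℕ, ((Λ n : ℝ) : ℂ) * ψ.primitiveCharacter n * V ((n : ℝ) / K)‖ ≤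
      M0 * (q.primeFactors.card * (Nat.log 2 ⌊2 * K⌋₊ + 1) * Real.log q) := by
  classical
  have hK0 : 0 < K := lt_of_lt_of_le zero_lt_one hK
  have hM00 : 0 ≤ M0 := (norm_nonneg _).trans (hM0 0)
  set N := ⌊2 * K⌋₊ with hN
  -- the primitive sum is a finite sum over `Icc 1 N`
  have hvan : ∀ n : ℕ, n ∉ Finset.Icc 1 N → ((Λ n : ℝ) : ℂ) * ψ.primitiveCharacter n * V ((n : ℝ) / K) = 0 := by
    intro n hn
    rw [Finset.mem_Icc, not_and_or, not_le, not_le] at hn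
    rcases hn with hn | hn
    · have : n = 0 := by omega
      subst this; simp
    · have h2 : 2 < (n : ℝ) / K := by
        rw [lt_div_iff₀ hK0]
        have := Nat.lt_of_floor_lt hn
        linarith
      rw [eq_zero_of_two_lt hsupp h2, mul_zero]
  rw [tsum_eq_sum (s := Finset.Icc 1 N) (fun n hn ↦ hvan n hn), ← Finset.sum_sub_distrib]
  -- termwise: the difference vanishes for `(n, q) = 1` and is `−Λ(n)ψ⋆(n)V(n/K)` otherwise
  have hterm : ∀ n ∈ Finset.Icc 1 N,
      ‖((Λ n : ℝ) : ℂ) * ψ (n : ZMod q) * V ((n : ℝ) / K) -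
          ((Λ n : ℝ) : ℂ) * ψ.primitiveCharacter n * V ((n : ℝ) / K)‖ ≤
        if n.Coprime q then 0 else Λ n * M0 := by
    intro n _
    by_cases hc : n.Coprime q
    · rw [if_pos hc]
      have hcop : IsCoprime (n : ℤ) (q : ℤ) := Nat.isCoprime_iff_coprime.2 hc
      have := ψ.primitiveCharacter_apply_of_isCoprime hcop
      simp only [Int.cast_natCast] at this
      rw [this, sub_self, norm_zero]
    · rw [if_neg hc]
      have hψ : ψ (n : ZMod q) = 0 :=
        MulChar.map_nonunit ψ (mt (ZMod.isUnit_iff_coprime n q).1 hc)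
      rw [hψ, mul_zero, zero_mul, zero_sub, norm_neg, norm_mul, norm_mul, Complex.norm_real,
        Real.norm_of_nonneg ArithmeticFunction.vonMangoldt_nonneg]
      have hΛ : 0 ≤ Λ n := ArithmeticFunction.vonMangoldt_nonneg
      calc Λ n * ‖ψ.primitiveCharacter (n : ZMod ψ.conductor)‖ * ‖V ((n : ℝ) / K)‖ ≤ Λ n * 1 * M0 :=
            mul_le_mul (mul_le_mul_of_nonneg_left (DirichletCharacter.norm_le_one _ _) hΛ) (hM0 _)
              (norm_nonneg _) (by positivity)
        _ = Λ n * M0 := by ring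
  calc ‖∑ n ∈ Finset.Icc 1 N, (((Λ n : ℝ) : ℂ) * ψ (n : ZMod q) * V ((n : ℝ) / K) -
          ((Λ n : ℝ) : ℂ) * ψ.primitiveCharacter n * V ((n : ℝ) / K))‖
      ≤ ∑ n ∈ Finset.Icc 1 N, (if n.Coprime q then (0 : ℝ) else Λ n * M0) := norm_sum_le_of_le _ hterm
    _ = ∑ n ∈ (Finset.Icc 1 N).filter (fun n ↦ ¬ n.Coprime q), Λ n * M0 := by
        rw [Finset.sum_filter]
        exact Finset.sum_congr rfl fun n _ ↦ by by_cases h : n.Coprime q <;> simp [h]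
    _ = M0 * ∑ n ∈ (Finset.Icc 1 N).filter (fun n ↦ ¬ n.Coprime q), Λ n := by
        rw [Finset.mul_sum]; exact Finset.sum_congr rfl fun n _ ↦ mul_comm _ _
    _ ≤ M0 * (q.primeFactors.card * (Nat.log 2 N + 1) * Real.log q) :=
        mul_le_mul_of_nonneg_left (sum_vonMangoldt_not_coprime_le (NeZero.ne q) N) hM00

/-- **Characters inject into (conductor, primitive character)** — divisor form: for non-negative `G`,
`Σ_{ψ mod q} G(cond ψ, ψ⋆) ≤ Σ_{d ∣ q} Σ_{ξ mod d primitive} G(d, ξ)`. [cite: BondarenkoHeap2026, Lemma 10, proof (TeX l.1195–1200: Σ_ψ F(ψ*) = Σ_{d∣q} Σ* F(ξ))] -/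
theorem sum_conductor_primitiveCharacter_le_divisors {q : ℕ} [NeZero q]
    (G : (d : ℕ) → DirichletCharacter ℂ d → ℝ) (hG : ∀ d ξ, 0 ≤ G d ξ)
    (D : (d : ℕ) → DecidablePred (fun ξ : DirichletCharacter ℂ d ↦ ξ.IsPrimitive)) :
    ∑ ψ : DirichletCharacter ℂ q, G ψ.conductor ψ.primitiveCharacter ≤
      ∑ d ∈ q.divisors, ∑ ξ ∈ @Finset.filter _ (fun ξ : DirichletCharacter ℂ d ↦ ξ.IsPrimitive)
        (D d) Finset.univ, G d ξ := by
  classical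
  set Φ : DirichletCharacter ℂ q → (Σ d : ℕ, DirichletCharacter ℂ d) :=
    fun ψ ↦ ⟨ψ.conductor, ψ.primitiveCharacter⟩ with hΦ
  have key : ∀ {n₁ n₂ : ℕ} (ψ₁ : DirichletCharacter ℂ n₁) (ψ₂ : DirichletCharacter ℂ n₂)
      (h₁ : n₁ ∣ q) (h₂ : n₂ ∣ q),
      (⟨n₁, ψ₁⟩ : Σ d : ℕ, DirichletCharacter ℂ d) = ⟨n₂, ψ₂⟩ →
        DirichletCharacter.changeLevel h₁ ψ₁ = DirichletCharacter.changeLevel h₂ ψ₂ := by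
    intro n₁ n₂ ψ₁ ψ₂ h₁ h₂ h
    cases h
    rfl
  have hinj : ∀ ψ₁ ∈ (Finset.univ : Finset (DirichletCharacter ℂ q)), ∀ ψ₂ ∈ (Finset.univ : Finset _),
      Φ ψ₁ = Φ ψ₂ → ψ₁ = ψ₂ := by
    intro ψ₁ _ ψ₂ _ h
    have := key ψ₁.primitiveCharacter ψ₂.primitiveCharacter ψ₁.conductor_dvd_level
      ψ₂.conductor_dvd_level h
    rwa [DirichletCharacter.changeLevel_primitiveCharacter,
      DirichletCharacter.changeLevel_primitiveCharacter] at this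
  have hsub : (Finset.univ : Finset (DirichletCharacter ℂ q)).image Φ ⊆
      q.divisors.sigma (fun d ↦ @Finset.filter _
        (fun ξ : DirichletCharacter ℂ d ↦ ξ.IsPrimitive) (D d) Finset.univ) := by
    intro x hx
    obtain ⟨ψ, -, rfl⟩ := Finset.mem_image.mp hx
    refine Finset.mem_sigma.mpr ⟨?_, ?_⟩
    · exact Nat.mem_divisors.2 ⟨ψ.conductor_dvd_level, NeZero.ne q⟩
    · exact Finset.mem_filter.mpr ⟨Finset.mem_univ _, ψ.primitiveCharacter_isPrimitive⟩
  calc ∑ ψ : DirichletCharacter ℂ q, G ψ.conductor ψ.primitiveCharacter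
      = ∑ x ∈ (Finset.univ : Finset (DirichletCharacter ℂ q)).image Φ, G x.1 x.2 := by
        rw [Finset.sum_image hinj]
    _ ≤ ∑ x ∈ q.divisors.sigma (fun d ↦ @Finset.filter _
          (fun ξ : DirichletCharacter ℂ d ↦ ξ.IsPrimitive) (D d) Finset.univ), G x.1 x.2 :=
        Finset.sum_le_sum_of_subset_of_nonneg hsub fun x _ _ ↦ hG _ _
    _ = _ := by rw [Finset.sum_sigma']

/-- **Layer cake** (TeX l.1244–1256): for finitely many `β_i ∈ (1/2, 1]` with weights `w_i ≥ 0` and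
`K > 1`, `Σ_i w_i K^{β_i − 1} = K^{−1/2} Σ_i w_i + log K ∫_{1/2}^1 K^{σ−1} A(σ) dσ` where
`A(σ) = Σ_{i : σ < β_i} w_i`; stated as the inequality `≤` that is used.
[cite: BondarenkoHeap2026, Lemma 10, proof (37)] -/
theorem layerCake_le {ι : Type*} (Z : Finset ι) (β w : ι → ℝ)
    (hβ : ∀ i ∈ Z, 1 / 2 < β i ∧ β i ≤ 1) {K : ℝ} (hK : 1 < K) :
    ∑ i ∈ Z, w i * K ^ (β i - 1) =
      K ^ (-(1 / 2) : ℝ) * ∑ i ∈ Z, w i +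
        Real.log K * ∫ σ in (1 / 2 : ℝ)..1, ∑ i ∈ Z, (if σ < β i then w i * K ^ (σ - 1) else 0) := by
  have hK0 : 0 < K := by linarith
  have hlog : 0 < Real.log K := Real.log_pos hK
  -- each term: FTC on `[1/2, β_i]`, then pad with zero up to `1`
  have hderiv : ∀ σ : ℝ, HasDerivAt (fun σ : ℝ ↦ K ^ (σ - 1)) (K ^ (σ - 1) * Real.log K) σ := by
    intro σ
    have h1 : HasDerivAt (fun x : ℝ ↦ K ^ x) (K ^ (σ - 1) * Real.log K) (σ - 1) :=
      (Real.hasStrictDerivAt_const_rpow hK0 (σ - 1)).hasDerivAt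
    have h2 : HasDerivAt (fun σ : ℝ ↦ σ - 1) 1 σ := (hasDerivAt_id σ).sub_const 1
    have := h1.comp σ h2
    rw [mul_one] at this
    exact this
  have hcont : Continuous fun σ : ℝ ↦ K ^ (σ - 1) :=
    Real.continuous_const_rpow hK0.ne' |>.comp (continuous_id.sub continuous_const)
  have hterm : ∀ i ∈ Z, w i * K ^ (β i - 1) = K ^ (-(1 / 2) : ℝ) * w i +
      Real.log K * ∫ σ in (1 / 2 : ℝ)..1, (if σ < β i then w i * K ^ (σ - 1) else 0) := by
    intro i hi
    obtain ⟨h1, h2⟩ := hβ i hi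
    have hftc : ∫ σ in (1 / 2 : ℝ)..β i, K ^ (σ - 1) * Real.log K = K ^ (β i - 1) - K ^ ((1 / 2 : ℝ) - 1) :=
      intervalIntegral.integral_eq_sub_of_hasDerivAt (fun σ _ ↦ hderiv σ)
        ((hcont.mul continuous_const).intervalIntegrable _ _)
    -- the padded integrand equals the indicator of `Iic (β i)` a.e.; use `integral_indicator`
    have hind : ∫ σ in (1 / 2 : ℝ)..1, (if σ < β i then w i * K ^ (σ - 1) else 0) =
        ∫ σ in (1 / 2 : ℝ)..β i, w i * K ^ (σ - 1) := by
      rw [← intervalIntegral.integral_indicator (f := fun σ ↦ w i * K ^ (σ - 1)) (by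
        constructor <;> linarith : β i ∈ Icc (1 / 2 : ℝ) 1)]
      refine intervalIntegral.integral_congr_ae ?_
      have : ∀ᵐ σ : ℝ ∂volume, σ ≠ β i := by
        simp [ae_iff]
      filter_upwards [this] with σ hσ _
      by_cases h : σ < β i
      · rw [if_pos h, indicator_of_mem (show σ ∈ {x | x ≤ β i} from h.le)]
      · rw [if_neg h, indicator_of_notMem]
        simp only [mem_setOf_eq, not_le]
        exact lt_of_le_of_ne (not_lt.1 h) (Ne.symm hσ)
    rw [hind, intervalIntegral.integral_const_mul]
    have : ∫ σ in (1 / 2 : ℝ)..β i, K ^ (σ - 1) = (K ^ (β i - 1) - K ^ ((1 / 2 : ℝ) - 1)) / Real.log K := by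
      rw [eq_div_iff hlog.ne', ← hftc, ← intervalIntegral.integral_mul_const]
    rw [this, show ((1 / 2 : ℝ) - 1) = -(1 / 2) by norm_num]
    field_simp
    ring
  rw [Finset.sum_congr rfl hterm, Finset.sum_add_distrib, ← Finset.mul_sum, ← Finset.mul_sum,
    intervalIntegral.integral_finsetSum]
  intro i hi
  -- integrability of the padded term
  have hmeas : IntervalIntegrable (fun σ ↦ w i * K ^ (σ - 1)) volume (1 / 2 : ℝ) 1 :=
    (continuous_const.mul hcont).intervalIntegrable _ _
  have := (hmeas.1.indicator (measurableSet_Iio (a := β i)))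
  have h2 := (hmeas.2.indicator (measurableSet_Iio (a := β i)))
  refine ⟨this.congr_fun (fun σ _ ↦ ?_) measurableSet_Ioc, h2.congr_fun (fun σ _ ↦ ?_) measurableSet_Ioc⟩ <;>
  · simp only [indicator, mem_Iio]

/-- Interval integrability of one padded layer-cake term. [folklore] -/
private theorem intervalIntegrable_layerTerm {K : ℝ} (hK : 0 < K) (β w a b : ℝ) :
    IntervalIntegrable (fun σ : ℝ ↦ if σ < β then w * K ^ (σ - 1) else 0) volume a b := by
  have hcont : Continuous fun σ : ℝ ↦ K ^ (σ - 1) :=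
    Real.continuous_const_rpow hK.ne' |>.comp (continuous_id.sub continuous_const)
  have hmeas : IntervalIntegrable (fun σ ↦ w * K ^ (σ - 1)) volume a b :=
    (continuous_const.mul hcont).intervalIntegrable _ _
  have h1 := (hmeas.1.indicator (measurableSet_Iio (a := β)))
  have h2 := (hmeas.2.indicator (measurableSet_Iio (a := β)))
  refine ⟨h1.congr_fun (fun σ _ ↦ ?_) measurableSet_Ioc, h2.congr_fun (fun σ _ ↦ ?_) measurableSet_Ioc⟩ <;>
  · simp only [indicator, mem_Iio]

/-- `∫_{1/2}^1 K^{σ−1} Y^{1−σ} dσ ≤ 1/log(K/Y)` for `0 < Y < K`. [folklore] -/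
private theorem integral_rpow_mul_rpow_le {K Y : ℝ} (hY : 0 < Y) (hYK : Y < K) :
    ∫ σ in (1 / 2 : ℝ)..1, K ^ (σ - 1) * Y ^ (1 - σ) ≤ 1 / Real.log (K / Y) := by
  have hK : 0 < K := hY.trans hYK
  set L := Real.log (K / Y) with hL
  have hL0 : 0 < L := Real.log_pos ((one_lt_div hY).2 hYK)
  have hLK : L = Real.log K - Real.log Y := Real.log_div hK.ne' hY.ne'
  have hfun : ∀ σ : ℝ, K ^ (σ - 1) * Y ^ (1 - σ) = rexp (L * (σ - 1)) := by
    intro σ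
    rw [Real.rpow_def_of_pos hK, Real.rpow_def_of_pos hY, ← Real.exp_add, hLK]
    congr 1; ring
  simp_rw [hfun]
  have hderiv : ∀ σ ∈ uIcc (1 / 2 : ℝ) 1,
      HasDerivAt (fun σ : ℝ ↦ rexp (L * (σ - 1)) / L) (rexp (L * (σ - 1))) σ := by
    intro σ _
    have h1 : HasDerivAt (fun σ : ℝ ↦ L * (σ - 1)) L σ := by
      simpa using ((hasDerivAt_id σ).sub_const 1).const_mul L
    have h2 := (Real.hasDerivAt_exp (L * (σ - 1))).comp σ h1
    have h3 : HasDerivAt (fun σ : ℝ ↦ rexp (L * (σ - 1)) / L) (rexp (L * (σ - 1)) * L / L) σ :=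
      h2.div_const L
    rwa [mul_div_assoc, div_self hL0.ne', mul_one] at h3
  rw [intervalIntegral.integral_eq_sub_of_hasDerivAt hderiv
    ((Real.continuous_exp.comp (continuous_const.mul (continuous_id.sub continuous_const))).intervalIntegrable _ _)]
  simp only [sub_self, mul_zero, Real.exp_zero]
  rw [div_sub_div_same, div_le_div_iff_of_pos_right hL0]
  linarith [Real.exp_pos (L * (1 / 2 - 1))]

/-- **The layer-cake bound**: under `A(σ) ≤ D·Y^{1−σ}` on `[1/2, 1)` (zero-density shape) with
`1 ≤ Y < K`, `D ≥ 0`: `Σ_i w_i K^{β_i−1} ≤ D + log K · D / log(K/Y)`.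
[cite: BondarenkoHeap2026, Lemma 10, proof (37)–(38)] -/
theorem layerCake_bound {ι : Type*} (Z : Finset ι) (β w : ι → ℝ)
    (hβ : ∀ i ∈ Z, 1 / 2 < β i ∧ β i ≤ 1) {K Y D : ℝ} (hK : 1 < K) (hY : 1 ≤ Y) (hYK : Y < K)
    (hD : 0 ≤ D)
    (hA : ∀ σ : ℝ, 1 / 2 ≤ σ → σ < 1 → ∑ i ∈ Z, (if σ < β i then w i else 0) ≤ D * Y ^ (1 - σ)) :
    ∑ i ∈ Z, w i * K ^ (β i - 1) ≤ D + Real.log K * (D / Real.log (K / Y)) := by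
  have hK0 : 0 < K := by linarith
  have hY0 : 0 < Y := by linarith
  have hlog : 0 < Real.log K := Real.log_pos hK
  rw [layerCake_le Z β w hβ hK]
  -- pointwise bound for the padded sums on `[1/2, 1]`
  have hA' : ∀ σ ∈ Icc (1 / 2 : ℝ) 1,
      ∑ i ∈ Z, (if σ < β i then w i * K ^ (σ - 1) else 0) ≤ D * (K ^ (σ - 1) * Y ^ (1 - σ)) := by
    intro σ hσ
    have hfac : ∑ i ∈ Z, (if σ < β i then w i * K ^ (σ - 1) else 0) =
        K ^ (σ - 1) * ∑ i ∈ Z, (if σ < β i then w i else 0) := by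
      rw [Finset.mul_sum]
      refine Finset.sum_congr rfl fun i _ ↦ ?_
      split_ifs <;> ring
    rw [hfac]
    rcases hσ.2.lt_or_eq with hσ1 | hσ1
    · calc K ^ (σ - 1) * ∑ i ∈ Z, (if σ < β i then w i else 0) ≤ K ^ (σ - 1) * (D * Y ^ (1 - σ)) :=
            mul_le_mul_of_nonneg_left (hA σ hσ.1 hσ1) (Real.rpow_nonneg hK0.le _)
        _ = D * (K ^ (σ - 1) * Y ^ (1 - σ)) := by ring
    · subst hσ1
      have : ∑ i ∈ Z, (if (1 : ℝ) < β i then w i else 0) = 0 :=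
        Finset.sum_eq_zero fun i hi ↦ by rw [if_neg (not_lt.2 (hβ i hi).2)]
      rw [this, mul_zero]
      positivity
  have hint : ∫ σ in (1 / 2 : ℝ)..1, ∑ i ∈ Z, (if σ < β i then w i * K ^ (σ - 1) else 0) ≤
      ∫ σ in (1 / 2 : ℝ)..1, D * (K ^ (σ - 1) * Y ^ (1 - σ)) := by
    refine intervalIntegral.integral_mono_on (by norm_num) ?_ ?_ hA'
    · have h := IntervalIntegrable.sum Z fun i (_ : i ∈ Z) ↦
        intervalIntegrable_layerTerm hK0 (β i) (w i) (1 / 2 : ℝ) 1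
      have hfn : (fun σ : ℝ ↦ ∑ i ∈ Z, (if σ < β i then w i * K ^ (σ - 1) else 0)) =
          ∑ i ∈ Z, fun σ : ℝ ↦ (if σ < β i then w i * K ^ (σ - 1) else 0) := by
        ext σ; simp only [Finset.sum_apply]
      rw [hfn]; exact h
    · refine (continuous_const.mul ((Real.continuous_const_rpow hK0.ne' |>.comp
        (continuous_id.sub continuous_const)).mul (Real.continuous_const_rpow hY0.ne' |>.comp
        (continuous_const.sub continuous_id)))).intervalIntegrable _ _
  have hint2 : ∫ σ in (1 / 2 : ℝ)..1, D * (K ^ (σ - 1) * Y ^ (1 - σ)) ≤ D * (1 / Real.log (K / Y)) := by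
    rw [intervalIntegral.integral_const_mul]
    exact mul_le_mul_of_nonneg_left (integral_rpow_mul_rpow_le hY0 hYK) hD
  -- the first term: `Σ w ≤ D Y^{1/2}` and `K^{-1/2} Y^{1/2} ≤ 1`
  have hsum : ∑ i ∈ Z, w i ≤ D * Y ^ (1 - 1 / 2 : ℝ) := by
    have := hA (1 / 2) le_rfl (by norm_num)
    rwa [Finset.sum_congr rfl fun i hi ↦ if_pos (hβ i hi).1] at this
  have hfirst : K ^ (-(1 / 2) : ℝ) * ∑ i ∈ Z, w i ≤ D := by
    have hKY : K ^ (-(1 / 2) : ℝ) * Y ^ (1 - 1 / 2 : ℝ) ≤ 1 := by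
      rw [show (1 - 1 / 2 : ℝ) = 1 / 2 by norm_num, Real.rpow_neg hK0.le, ← Real.inv_rpow hK0.le,
        ← Real.mul_rpow (inv_nonneg.2 hK0.le) hY0.le]
      apply Real.rpow_le_one (by positivity)
      · rw [inv_mul_le_iff₀ hK0]; linarith
      · norm_num
    calc K ^ (-(1 / 2) : ℝ) * ∑ i ∈ Z, w i ≤ K ^ (-(1 / 2) : ℝ) * (D * Y ^ (1 - 1 / 2 : ℝ)) :=
          mul_le_mul_of_nonneg_left hsum (Real.rpow_nonneg hK0.le _)
      _ = D * (K ^ (-(1 / 2) : ℝ) * Y ^ (1 - 1 / 2 : ℝ)) := by ring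
      _ ≤ D * 1 := mul_le_mul_of_nonneg_left hKY hD
      _ = D := mul_one _
  have := mul_le_mul_of_nonneg_left (hint.trans hint2) hlog.le
  rw [show D * (1 / Real.log (K / Y)) = D / Real.log (K / Y) by ring] at this
  linarith

/-- Finite support: `Σ'_n Λ(n)c(n)V(n/K) = Σ_{1 ≤ n ≤ 2K} Λ(n)c(n)V(n/K)` for a weight supported in
`[1,2]` and `K > 0`. [folklore] -/
private theorem tsum_eq_sum_Icc (c : ℕ → ℂ) {V : ℝ → ℂ} (hsupp : ∀ x : ℝ, V x ≠ 0 → 1 ≤ x ∧ x ≤ 2)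
    {K : ℝ} (hK : 0 < K) :
    ∑' n : ℕ, ((Λ n : ℝ) : ℂ) * c n * V ((n : ℝ) / K) =
      ∑ n ∈ Finset.Icc 1 ⌊2 * K⌋₊, ((Λ n : ℝ) : ℂ) * c n * V ((n : ℝ) / K) := by
  refine tsum_eq_sum fun n hn ↦ ?_
  rw [Finset.mem_Icc, not_and_or, not_le, not_le] at hn
  rcases hn with hn | hn
  · have : n = 0 := by omega
    subst this; simp
  · have h2 : 2 < (n : ℝ) / K := by
      rw [lt_div_iff₀ hK]
      have := Nat.lt_of_floor_lt hn
      linarith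
    rw [eq_zero_of_two_lt hsupp h2, mul_zero]

/-- Splitting into real and imaginary parts:
`‖Σ Λ c V‖ ≤ ‖Σ Λ c (Re V)‖ + ‖Σ Λ c (Im V)‖`. [folklore] -/
private theorem norm_sum_le_re_add_im (c : ℕ → ℂ) (V : ℝ → ℂ) (S : Finset ℕ) (K : ℝ) :
    ‖∑ n ∈ S, ((Λ n : ℝ) : ℂ) * c n * V ((n : ℝ) / K)‖ ≤
      ‖∑ n ∈ S, ((Λ n : ℝ) : ℂ) * c n * ((V ((n : ℝ) / K)).re : ℂ)‖ +
        ‖∑ n ∈ S, ((Λ n : ℝ) : ℂ) * c n * ((V ((n : ℝ) / K)).im : ℂ)‖ := by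
  have hsplit : ∑ n ∈ S, ((Λ n : ℝ) : ℂ) * c n * V ((n : ℝ) / K) =
      ∑ n ∈ S, ((Λ n : ℝ) : ℂ) * c n * ((V ((n : ℝ) / K)).re : ℂ) +
        (∑ n ∈ S, ((Λ n : ℝ) : ℂ) * c n * ((V ((n : ℝ) / K)).im : ℂ)) * I := by
    rw [Finset.sum_mul, ← Finset.sum_add_distrib]
    refine Finset.sum_congr rfl fun n _ ↦ ?_
    conv_lhs => rw [← Complex.re_add_im (V ((n : ℝ) / K))]
    ring
  rw [hsplit]
  refine (norm_add_le _ _).trans ?_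
  rw [norm_mul, Complex.norm_I, mul_one]

/-- `Re V` (as a complex-valued function) is smooth. [folklore] -/
private theorem contDiff_re_ofReal {V : ℝ → ℂ} (hV : ContDiff ℝ ∞ V) :
    ContDiff ℝ ∞ (fun x ↦ ((V x).re : ℂ)) :=
  (Complex.ofRealCLM.comp Complex.reCLM).contDiff.comp hV

/-- `Im V` (as a complex-valued function) is smooth. [folklore] -/
private theorem contDiff_im_ofReal {V : ℝ → ℂ} (hV : ContDiff ℝ ∞ V) :
    ContDiff ℝ ∞ (fun x ↦ ((V x).im : ℂ)) :=
  (Complex.ofRealCLM.comp Complex.imCLM).contDiff.comp hV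

/-- `Re V` is smooth (real-valued). [folklore] -/
private theorem contDiff_re {V : ℝ → ℂ} (hV : ContDiff ℝ ∞ V) : ContDiff ℝ ∞ (fun x ↦ (V x).re) :=
  Complex.reCLM.contDiff.comp hV

/-- `Im V` is smooth (real-valued). [folklore] -/
private theorem contDiff_im {V : ℝ → ℂ} (hV : ContDiff ℝ ∞ V) : ContDiff ℝ ∞ (fun x ↦ (V x).im) :=
  Complex.imCLM.contDiff.comp hV

/-- `‖(Re V)^{(i)}‖ ≤ ‖V^{(i)}‖`. [folklore] -/
private theorem norm_iteratedDeriv_re_le {V : ℝ → ℂ} (hV : ContDiff ℝ ∞ V) (i : ℕ) (x : ℝ) :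
    ‖iteratedDeriv i (fun x ↦ ((V x).re : ℂ)) x‖ ≤ ‖iteratedDeriv i V x‖ := by
  have h := norm_iteratedDeriv_clm_comp_le (Complex.ofRealCLM.comp Complex.reCLM)
    (fun z ↦ by simpa using Complex.abs_re_le_norm z) hV i x
  simpa using h

/-- `‖(Im V)^{(i)}‖ ≤ ‖V^{(i)}‖`. [folklore] -/
private theorem norm_iteratedDeriv_im_le {V : ℝ → ℂ} (hV : ContDiff ℝ ∞ V) (i : ℕ) (x : ℝ) :
    ‖iteratedDeriv i (fun x ↦ ((V x).im : ℂ)) x‖ ≤ ‖iteratedDeriv i V x‖ := by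
  have h := norm_iteratedDeriv_clm_comp_le (Complex.ofRealCLM.comp Complex.imCLM)
    (fun z ↦ by simpa using Complex.abs_im_le_norm z) hV i x
  simpa using h

/-- **Aggregate layer cake for one modulus** (TeX l.1244–1283): if the characters of `P` (mod `d`)
satisfy the zero-density shape `Σ_{ξ ∈ P} N(σ, H, ξ) ≤ D·Y^{1−σ}` for `σ ∈ [1/2, 1)`, `1 ≤ Y < K`,
then `Σ_{ξ ∈ P, ξ ≠ χ₀} Σ_{|γ|≤H, β>1/2} m_ξ(ρ) K^{β−1} ≤ D + log K · D / log(K/Y)`.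
[cite: BondarenkoHeap2026, Lemma 10, proof (37)–(38)] -/
theorem sum_primitive_layer_le {d : ℕ} [NeZero d] {H K Y D : ℝ} (hK : 1 < K) (hY : 1 ≤ Y)
    (hYK : Y < K) (hD : 0 ≤ D)
    (P : Finset (DirichletCharacter ℂ d))
    (hN : ∀ σ : ℝ, 1 / 2 ≤ σ → σ < 1 →
      ∑ ξ ∈ P, (charZeroCountRe ξ σ H : ℝ) ≤ D * Y ^ (1 - σ)) :
    ∑ ξ ∈ P, (if hξ : ξ = 1 then (0 : ℝ) else
        ∑ z ∈ (lfunctionZeroBox_finite hξ H).toFinset,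
          if 1 / 2 < z.re then (DirichletDisc.zeroOrder ξ z : ℝ) * K ^ (z.re - 1) else 0) ≤
      D + Real.log K * (D / Real.log (K / Y)) := by
  classical
  -- the finite set of pairs `(ξ, ρ)` with `ξ ∈ P`, `ξ ≠ χ₀`, `ρ` in the box, `Re ρ > 1/2`
  set t : (ξ : DirichletCharacter ℂ d) → Finset ℂ := fun ξ ↦
    if hξ : ξ = 1 then ∅ else ((lfunctionZeroBox_finite hξ H).toFinset.filter fun z ↦ 1 / 2 < z.re)
    with ht
  set Z : Finset (Σ _ : DirichletCharacter ℂ d, ℂ) := P.sigma t with hZ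
  have hmemt : ∀ {ξ : DirichletCharacter ℂ d} {z : ℂ}, z ∈ t ξ →
      ∃ hξ : ξ ≠ 1, z ∈ lfunctionZeroBox ξ H ∧ 1 / 2 < z.re := by
    intro ξ z hz
    by_cases hξ : ξ = 1
    · simp [ht, hξ] at hz
    · simp only [ht, dif_neg hξ, Finset.mem_filter, Set.Finite.mem_toFinset] at hz
      exact ⟨hξ, hz.1, hz.2⟩
  -- rewrite the left-hand side as a sum over `Z`
  have hLHS : ∑ ξ ∈ P, (if hξ : ξ = 1 then (0 : ℝ) else
      ∑ z ∈ (lfunctionZeroBox_finite hξ H).toFinset,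
        if 1 / 2 < z.re then (DirichletDisc.zeroOrder ξ z : ℝ) * K ^ (z.re - 1) else 0) =
      ∑ x ∈ Z, (DirichletDisc.zeroOrder x.1 x.2 : ℝ) * K ^ (x.2.re - 1) := by
    rw [hZ, Finset.sum_sigma]
    refine Finset.sum_congr rfl fun ξ _ ↦ ?_
    by_cases hξ : ξ = 1
    · simp [ht, hξ]
    · rw [dif_neg hξ]
      simp only [ht, dif_neg hξ]
      rw [Finset.sum_filter]
  rw [hLHS]
  refine layerCake_bound Z (fun x ↦ x.2.re) (fun x ↦ (DirichletDisc.zeroOrder x.1 x.2 : ℝ)) ?_ hK hY hYK hD ?_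
  · intro x hx
    rw [hZ, Finset.mem_sigma] at hx
    obtain ⟨_, hbox, hre⟩ := hmemt hx.2
    exact ⟨hre, (mem_lfunctionZeroBox.1 hbox).2.2.1.le⟩
  · intro σ hσ hσ1
    have hσ0 : 0 ≤ σ := by linarith
    rw [hZ, Finset.sum_sigma]
    refine le_trans (Finset.sum_le_sum fun ξ hξP ↦ ?_) (hN σ hσ hσ1)
    -- per character: the filtered box sum is at most `N(σ, H, ξ)`
    by_cases hξ : ξ = 1
    · simp [ht, hξ]
    · have hsub : (t ξ).filter (fun z ↦ σ < z.re) ⊆ (zeroSetRe_finite hξ hσ0 H).toFinset := by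
        intro z hz
        rw [Finset.mem_filter] at hz
        obtain ⟨_, hbox, _⟩ := hmemt hz.1
        rw [Set.Finite.mem_toFinset, mem_zeroSetRe]
        rw [mem_lfunctionZeroBox] at hbox
        exact ⟨hbox.1, hz.2, hbox.2.2.2⟩
      have hnat : ∑ z ∈ (t ξ).filter (fun z ↦ σ < z.re), DirichletDisc.zeroOrder ξ z ≤
          charZeroCountRe ξ σ H := by
        rw [charZeroCountRe, finsum_mem_eq_finite_toFinset_sum _ (zeroSetRe_finite hξ hσ0 H)]
        exact Finset.sum_le_sum_of_subset_of_nonneg hsub fun _ _ _ ↦ Nat.zero_le _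
      calc ∑ z ∈ t ξ, (if σ < z.re then (DirichletDisc.zeroOrder ξ z : ℝ) else 0)
          = ∑ z ∈ (t ξ).filter (fun z ↦ σ < z.re), (DirichletDisc.zeroOrder ξ z : ℝ) := by
            rw [Finset.sum_filter]
        _ ≤ (charZeroCountRe ξ σ H : ℝ) := by exact_mod_cast hnat

/-- For `ψ ≠ χ₀`: `ψ⋆ ≠ χ₀`. [folklore] -/
private theorem primitiveCharacter_ne_one {q : ℕ} [NeZero q] {ψ : DirichletCharacter ℂ q} (hψ : ψ ≠ 1) :
    ψ.primitiveCharacter ≠ 1 := by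
  intro h
  apply hψ
  have := DirichletCharacter.changeLevel_primitiveCharacter ψ
  rw [h, DirichletCharacter.changeLevel_one] at this
  exact this.symm

end aggregate

/-! ### Part E: assembly of Lemma 10 -/

section assembly

/-- The weighted count `S₃(d, ξ) = Σ_{ρ ∈ box_ξ(H), Re ρ > 1/2} m_ξ(ρ) K^{Re ρ − 1}` as a total function
of `(d, ξ)` (zero at `d = 0` and at `ξ = χ₀`), for the aggregation over conductors; written inline as a
`dite`. There are `φ(q) ≤ q` characters mod `q`. [folklore] -/
private theorem card_filter_ne_one_le (q : ℕ) [NeZero q] :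
    ((Finset.univ.filter fun ψ : DirichletCharacter ℂ q ↦ ψ ≠ 1).card : ℝ) ≤ q := by
  classical
  have h1 : (Finset.univ.filter fun ψ : DirichletCharacter ℂ q ↦ ψ ≠ 1).card ≤
      Fintype.card (DirichletCharacter ℂ q) := Finset.card_filter_le _ _
  have h2 : Fintype.card (DirichletCharacter ℂ q) = q.totient := by
    rw [← Nat.card_eq_fintype_card]
    exact DirichletCharacter.card_eq_totient_of_hasEnoughRootsOfUnity ℂ q
  exact_mod_cast h1.trans (h2 ▸ Nat.totient_le q)

open Classical in
/-- **Aggregation over the characters mod `q`** (TeX l.1195–1200 and (38)): if for every `d ∣ q` the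
primitive characters mod `d` satisfy `Σ*_ξ N(σ,H,ξ) ≤ D·Y^{1−σ}` (`σ ∈ [1/2,1)`), then
`Σ_{ψ ≠ χ₀ mod q} S₃(ψ⋆) ≤ τ(q) · (D + log K · D/log(K/Y))`. [cite: BondarenkoHeap2026, Lemma 10, proof (38)] -/
theorem sum_layer_le_card_divisors_mul {q : ℕ} [NeZero q] {H K Y D : ℝ} (hK : 1 < K) (hY : 1 ≤ Y)
    (hYK : Y < K) (hD : 0 ≤ D)
    (hN : ∀ d ∈ q.divisors, ∀ (_ : NeZero d), ∀ σ : ℝ, 1 / 2 ≤ σ → σ < 1 →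
      ∑ ξ ∈ (Finset.univ.filter fun ξ : DirichletCharacter ℂ d ↦ ξ.IsPrimitive),
        (charZeroCountRe ξ σ H : ℝ) ≤ D * Y ^ (1 - σ)) :
    ∑ ψ ∈ (Finset.univ.filter fun ψ : DirichletCharacter ℂ q ↦ ψ ≠ 1),
        (if hd : ψ.conductor = 0 then (0 : ℝ) else
          haveI : NeZero ψ.conductor := ⟨hd⟩
          if hξ : ψ.primitiveCharacter = 1 then (0 : ℝ) else
            ∑ z ∈ (lfunctionZeroBox_finite hξ H).toFinset,
              if 1 / 2 < z.re then (DirichletDisc.zeroOrder ψ.primitiveCharacter z : ℝ) * K ^ (z.re - 1)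
              else 0) ≤
      (q.divisors.card : ℝ) * (D + Real.log K * (D / Real.log (K / Y))) := by
  classical
  -- the total function of `(d, ξ)`
  set G : (d : ℕ) → DirichletCharacter ℂ d → ℝ := fun d ξ ↦
    if hd : d = 0 then 0 else
      haveI : NeZero d := ⟨hd⟩
      if hξ : ξ = 1 then 0 else
        ∑ z ∈ (lfunctionZeroBox_finite hξ H).toFinset,
          if 1 / 2 < z.re then (DirichletDisc.zeroOrder ξ z : ℝ) * K ^ (z.re - 1) else 0 with hG
  have hK0 : 0 < K := by linarith
  have hG0 : ∀ d ξ, 0 ≤ G d ξ := by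
    intro d ξ
    simp only [hG]
    split_ifs
    · exact le_rfl
    · exact le_rfl
    · exact Finset.sum_nonneg fun z _ ↦ by split_ifs <;> positivity
  -- pass from the filtered sum to the full sum (the `ψ = 1` term is `0`)
  have hfull : ∑ ψ ∈ (Finset.univ.filter fun ψ : DirichletCharacter ℂ q ↦ ψ ≠ 1),
      G ψ.conductor ψ.primitiveCharacter ≤ ∑ ψ : DirichletCharacter ℂ q, G ψ.conductor ψ.primitiveCharacter :=
    Finset.sum_le_sum_of_subset_of_nonneg (Finset.filter_subset _ _) fun ψ _ _ ↦ hG0 _ _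
  refine hfull.trans ?_
  refine (sum_conductor_primitiveCharacter_le_divisors G hG0 (fun d ↦ inferInstance)).trans ?_
  -- each divisor contributes at most `D + log K · D / log(K/Y)`
  have hd : ∀ d ∈ q.divisors, ∑ ξ ∈ (Finset.univ.filter fun ξ : DirichletCharacter ℂ d ↦ ξ.IsPrimitive),
      G d ξ ≤ D + Real.log K * (D / Real.log (K / Y)) := by
    intro d hdq
    have hd0 : d ≠ 0 := Nat.pos_iff_ne_zero.1 (Nat.pos_of_mem_divisors hdq)
    haveI : NeZero d := ⟨hd0⟩
    have hGd : ∀ ξ : DirichletCharacter ℂ d, G d ξ = (if hξ : ξ = 1 then (0 : ℝ) else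
        ∑ z ∈ (lfunctionZeroBox_finite hξ H).toFinset,
          if 1 / 2 < z.re then (DirichletDisc.zeroOrder ξ z : ℝ) * K ^ (z.re - 1) else 0) := by
      intro ξ; simp only [hG, dif_neg hd0]
    rw [Finset.sum_congr rfl fun ξ _ ↦ hGd ξ]
    exact sum_primitive_layer_le hK hY hYK hD _ (hN d hdq inferInstance)
  calc ∑ d ∈ q.divisors, ∑ ξ ∈ (Finset.univ.filter fun ξ : DirichletCharacter ℂ d ↦ ξ.IsPrimitive), G d ξ
      ≤ ∑ d ∈ q.divisors, (D + Real.log K * (D / Real.log (K / Y))) := Finset.sum_le_sum hd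
    _ = (q.divisors.card : ℝ) * (D + Real.log K * (D / Real.log (K / Y))) := by
        rw [Finset.sum_const, nsmul_eq_mul]

/-- `log₂⌊2K⌋ + 1 ≤ 4 log(2K)` for `K ≥ 1` (crude). [folklore] -/
private theorem natLog_floor_add_one_le {K : ℝ} (hK : 1 ≤ K) :
    ((Nat.log 2 ⌊2 * K⌋₊ : ℕ) : ℝ) + 1 ≤ 4 * Real.log (2 * K) := by
  set N := ⌊2 * K⌋₊ with hN
  have h2K : (2 : ℝ) ≤ 2 * K := by linarith
  have hN2 : 2 ≤ N := by
    rw [hN]; exact Nat.le_floor (by exact_mod_cast h2K)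
  have hNpos : 0 < N := by omega
  have hNle : (N : ℝ) ≤ 2 * K := Nat.floor_le (by linarith)
  -- `2^{log₂ N} ≤ N`, so `log₂ N · log 2 ≤ log N ≤ log(2K)`
  have hpow : ((2 : ℕ) ^ Nat.log 2 N : ℝ) ≤ N := by exact_mod_cast Nat.pow_log_le_self 2 hNpos.ne'
  have hlog2 : (Nat.log 2 N : ℝ) * Real.log 2 ≤ Real.log (2 * K) := by
    have h1 : Real.log ((2 : ℝ) ^ Nat.log 2 N) ≤ Real.log (2 * K) :=
      Real.log_le_log (by positivity) ((by exact_mod_cast hpow : ((2 : ℝ) ^ Nat.log 2 N) ≤ N).trans hNle)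
    rwa [Real.log_pow] at h1
  have hl2 : (1 / 2 : ℝ) < Real.log 2 := by
    have := Real.log_two_gt_d9; linarith
  have hlog2K : Real.log 2 ≤ Real.log (2 * K) := Real.log_le_log two_pos h2K
  nlinarith [Nat.cast_nonneg (α := ℝ) (Nat.log 2 N)]

end assembly

end PrimeSums

set_option maxHeartbeats 1600000 in
open PrimeSums ExplicitPsiChar in
open Classical in
/-- **Bondarenko–Heap 2026, Lemma 10, from Proposition 2 — core form, with the profile hypothesis
restricted to what the printed proof uses.** The proof of Lemma 10 (TeX l.1124–1290) consumes the
profile `‖V^{(i)}‖_∞ ≪_i q^{ε₁}` of the weight only at the orders `i = 0` (trivial bounds), `i = 2`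
(the left line `Re w = −5/2` of the explicit formula) and `i = J(η) := ⌈7/(3η)⌉ + 3` (the Mellin
decay (34) beyond `|γ| > H = q^{3η/7}`), each time with the loss `q^{ε/4}`. This theorem is Lemma 10
with exactly that hypothesis — `‖V^{(i)}‖_∞ ≤ A_i q^{ε/4}` for `i ≤ J(η)` — and the printed
conclusion `∑_{ψ mod q, ψ ∉ {ψ₀,χ}} |∑_n Λ(n)ψ(n)V(n/K)| ≤ C(η, ε, A) K q^ε` for `K ≥ q^{7/3+2η}`;
`lemma10_of_prop2` below is its instantiation `ε₁ = ε/4`, and a weight class with loss `q^{iε₁}`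
at order `i` (the §6.2 Mellin-separated weights) is served by `ε₁ = ε/(4J(η))`. Proof exactly as
printed: reduction to the primitive inducing characters (`PrimeSums.norm_sum_sub_tsum_primitive_le`),
the smoothed explicit formula (`ExplicitPsiChar.charFordK_eq_explicit`, Heath-Brown's form of
(34)–(35), applied to the smoothing `f(u) = V(e^u/K)e^{5u/4}` whose Laplace transform is
`K^w 𝓜V(w)`), the Mellin decay (34) by `J`-fold integration by parts, the window count
`Σ_ρ m(ρ)/(1+γ²) ≪ log q` in place of (36) with `H = q^{3η/7}`, the layer-cake identity (37) and
`prop2` at each conductor `d ∣ q` with the divisor bound (38).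
[cite: BondarenkoHeap2026, Lemma 10 (proof, TeX l.1124–1290)] -/
theorem lemma10_of_prop2_of_derivBounds (h2 : prop2) {η : ℝ} (hη : 0 < η) {ε : ℝ} (hε : 0 < ε)
    (A : ℕ → ℝ) :
    ∃ C : ℝ, 0 < C ∧
      ∀ (q : ℕ) [NeZero q] (χ : DirichletCharacter ℂ q), χ.IsPrimitive → χ.IsQuadratic →
      ∀ (K : ℝ), (q : ℝ) ^ (7 / 3 + 2 * η) ≤ K →
      ∀ (V : ℝ → ℂ), ContDiff ℝ ∞ V → (∀ x : ℝ, V x ≠ 0 → 1 ≤ x ∧ x ≤ 2) →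
        (∀ (i : ℕ) (x : ℝ), i ≤ ⌈7 / (3 * η)⌉₊ + 3 →
          ‖iteratedDeriv i V x‖ ≤ A i * (q : ℝ) ^ (ε / 4)) →
        ∑ ψ ∈ (Finset.univ.filter fun ψ : DirichletCharacter ℂ q ↦ ψ ≠ 1 ∧ ψ ≠ χ),
            ‖∑ n ∈ Finset.Icc 1 ⌊2 * K⌋₊, ((Λ n : ℝ) : ℂ) * ψ (n : ZMod q) * V ((n : ℝ) / K)‖ ≤
          C * K * (q : ℝ) ^ ε := by
  -- parameters `b = 3η/7`, `j = ⌈7/(3η)⌉ + 3`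
  set b : ℝ := 3 * η / 7 with hb
  have hb0 : 0 < b := by positivity
  set j : ℕ := ⌈7 / (3 * η)⌉₊ + 3 with hj
  have hj2 : 2 ≤ j := by omega
  have hbj : 1 ≤ b * ((j - 2 : ℕ) : ℝ) := by
    have h1 : ((j - 2 : ℕ) : ℝ) = (⌈7 / (3 * η)⌉₊ : ℝ) + 1 := by
      rw [hj, show ⌈7 / (3 * η)⌉₊ + 3 - 2 = ⌈7 / (3 * η)⌉₊ + 1 by omega]; push_cast; ring
    rw [h1]
    have h2 : 7 / (3 * η) ≤ (⌈7 / (3 * η)⌉₊ : ℝ) := Nat.le_ceil _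
    have h3 : b * (7 / (3 * η)) = 1 := by rw [hb]; field_simp
    nlinarith
  -- absolute constants from the tree and from `prop2`
  obtain ⟨Cw, hCw0, hCw⟩ := ExplicitPsiChar.exists_tsum_zeroOrder_div_sq_le
  obtain ⟨CJ, hCJ0, hCJ⟩ := ExplicitPsiChar.exists_norm_charEFRemainder_le
  set ε₂ : ℝ := ε / (4 * (1 + b)) with hε₂
  have hε₂0 : 0 < ε₂ := by positivity
  obtain ⟨C2, hC20, hC2⟩ := h2 ε₂ hε₂0
  obtain ⟨Cd, hCd1, hCd⟩ :=
    Literature.NumberTheory.Sieve.exists_card_divisors_le_mul_rpow (ε := ε / 4) (by positivity)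
  set A' : ℝ := 1 + |A 0| + |A 2| + |A j| with hA'
  have hA'1 : 1 ≤ A' := by
    rw [hA']; linarith [abs_nonneg (A 0), abs_nonneg (A 2), abs_nonneg (A j)]
  have hA'0 : 0 < A' := by linarith
  have hA0le : A 0 ≤ A' := by rw [hA']; linarith [le_abs_self (A 0), abs_nonneg (A 2), abs_nonneg (A j)]
  have hA2le : A 2 ≤ A' := by rw [hA']; linarith [le_abs_self (A 2), abs_nonneg (A 0), abs_nonneg (A j)]
  have hAjle : A j ≤ A' := by rw [hA']; linarith [le_abs_self (A j), abs_nonneg (A 0), abs_nonneg (A 2)]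
  set cη : ℝ := 1 + (7 / 3 + 2 * η) / η with hcη
  have hcη0 : 0 < cη := by positivity
  set C : ℝ := A' * (224 / ε + 2 ^ (j + 2) * 12 * Cw / ε + 48 * Cw / ε + 4 + 150 * CJ / ε +
    2 * Cd * C2 * cη) with hC
  have hCd0 : 0 < Cd := by linarith
  refine ⟨C, by positivity, ?_⟩
  intro q _ χ _ _ K hK V hV hsupp hAV
  have hq1 : (1 : ℝ) ≤ q := by exact_mod_cast NeZero.one_le
  have hq0 : (0 : ℝ) < q := by linarith
  have hKq : (q : ℝ) ≤ K := by
    refine le_trans ?_ hK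
    conv_lhs => rw [← Real.rpow_one (q : ℝ)]
    exact Real.rpow_le_rpow_of_exponent_le hq1 (by linarith)
  have hK0 : 0 < K := by linarith
  -- the set of characters in the statement, and all non-principal characters
  set F := Finset.univ.filter (fun ψ : DirichletCharacter ℂ q ↦ ψ ≠ 1 ∧ ψ ≠ χ) with hF
  set F1 := Finset.univ.filter (fun ψ : DirichletCharacter ℂ q ↦ ψ ≠ 1) with hF1
  have hFF1 : F ⊆ F1 := by
    intro ψ hψ
    simp only [hF, hF1, Finset.mem_filter, Finset.mem_univ, true_and] at hψ ⊢
    exact hψ.1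
  -- `q = 1`: nothing to prove
  rcases lt_or_ge q 2 with hq2 | hq2
  · have hq : q = 1 := by have := NeZero.one_le (n := q); omega
    have hF0 : F = ∅ := by
      rw [hF, Finset.filter_eq_empty_iff]
      intro ψ _ h
      exact h.1 (DirichletCharacter.level_one' ψ hq)
    rw [hF0, Finset.sum_empty]
    positivity
  -- from now on `q ≥ 2`, `K > 1`
  have hq2r : (2 : ℝ) ≤ q := by exact_mod_cast hq2
  have hK1 : 1 < K := by linarith
  have hlogq : 0 < Real.log q := Real.log_pos (by linarith)
  set H : ℝ := (q : ℝ) ^ b with hH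
  have hH1 : 1 ≤ H := Real.one_le_rpow hq1 hb0.le
  have hH0 : 0 < H := by linarith
  -- the profile of `V`
  set M0 : ℝ := A 0 * (q : ℝ) ^ (ε / 4) with hM0
  set M2 : ℝ := A 2 * (q : ℝ) ^ (ε / 4) with hM2
  set Mj : ℝ := A j * (q : ℝ) ^ (ε / 4) with hMj
  have hqε : 0 < (q : ℝ) ^ (ε / 4) := by positivity
  have hM0V : ∀ x, ‖V x‖ ≤ M0 := fun x ↦ by simpa using hAV 0 x (Nat.zero_le _)
  have hM2V : ∀ x, ‖iteratedDeriv 2 V x‖ ≤ M2 := fun x ↦ hAV 2 x hj2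
  have hMjV : ∀ x, ‖iteratedDeriv j V x‖ ≤ Mj := fun x ↦ hAV j x le_rfl
  have hM00 : 0 ≤ M0 := (norm_nonneg _).trans (hM0V 0)
  have hM20 : 0 ≤ M2 := (norm_nonneg _).trans (hM2V 0)
  have hMj0 : 0 ≤ Mj := (norm_nonneg _).trans (hMjV 0)
  have hM0le : M0 ≤ A' * (q : ℝ) ^ (ε / 4) := mul_le_mul_of_nonneg_right hA0le hqε.le
  have hM2le : M2 ≤ A' * (q : ℝ) ^ (ε / 4) := mul_le_mul_of_nonneg_right hA2le hqε.le
  have hMjle : Mj ≤ A' * (q : ℝ) ^ (ε / 4) := mul_le_mul_of_nonneg_right hAjle hqε.le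
  -- the logarithmic factors
  set ℓ : ℝ := Real.log q + Real.log 4 with hℓ
  have hlog4 : 0 < Real.log 4 := Real.log_pos (by norm_num)
  have hℓ0 : 0 < ℓ := by positivity
  set T : ℝ := Cw * ℓ with hT
  have hT0 : 0 ≤ T := by positivity
  set N := ⌊2 * K⌋₊ with hN
  -- the `ψ`-independent part of the per-character bound
  set R : ℝ := M0 * ((q : ℝ) * (4 * Real.log (2 * K)) * Real.log q) +
    2 * (K * (2 ^ (j + 1) * Mj / H ^ (j - 2)) * T + K ^ (1 / 2 : ℝ) * M0 * (1 + H ^ 2) * T +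
      2 * M0 + CJ * (25 / 4 * M2) * ℓ) with hR
  -- the layer term of `ψ` (as a total function of its conductor and primitive character)
  set S3 : DirichletCharacter ℂ q → ℝ := fun ψ ↦
    if hd : ψ.conductor = 0 then (0 : ℝ) else
      haveI : NeZero ψ.conductor := ⟨hd⟩
      if hξ : ψ.primitiveCharacter = 1 then (0 : ℝ) else
        ∑ z ∈ (lfunctionZeroBox_finite hξ H).toFinset,
          if 1 / 2 < z.re then (DirichletDisc.zeroOrder ψ.primitiveCharacter z : ℝ) * K ^ (z.re - 1)
          else 0 with hS3
  ---------------------------------------------------------------------------------------------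
  -- Step 1: the per-character bound `‖Σ_n Λψ(n)V(n/K)‖ ≤ R + 2 K M0 S3(ψ)` for `ψ ≠ χ₀`
  ---------------------------------------------------------------------------------------------
  have hper : ∀ ψ ∈ F1, ‖∑ n ∈ Finset.Icc 1 N, ((Λ n : ℝ) : ℂ) * ψ (n : ZMod q) * V ((n : ℝ) / K)‖ ≤
      R + 2 * (K * M0 * S3 ψ) := by
    intro ψ hψF
    have hψ : ψ ≠ 1 := by simpa [hF1] using hψF
    haveI hnz : NeZero ψ.conductor := ⟨ψ.conductor_ne_zero⟩
    have hξprim : ψ.primitiveCharacter.IsPrimitive := DirichletCharacter.primitiveCharacter_isPrimitive ψ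
    have hξ1 : ψ.primitiveCharacter ≠ 1 := primitiveCharacter_ne_one hψ
    have hd1 : 1 < ψ.conductor := by
      have h0 := ψ.conductor_ne_zero
      have h1 : ψ.conductor ≠ 1 := fun h ↦ hψ (DirichletCharacter.eq_one_iff_conductor_eq_one.2 h)
      omega
    have hdq : (ψ.conductor : ℝ) ≤ q := by
      exact_mod_cast Nat.le_of_dvd (NeZero.pos q) ψ.conductor_dvd_level
    have hd1r : (1 : ℝ) < ψ.conductor := by exact_mod_cast hd1
    have hlogd : Real.log ψ.conductor ≤ Real.log q := Real.log_le_log (by linarith) hdq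
    have hlogd0 : 0 ≤ Real.log (ψ.conductor : ℝ) := Real.log_nonneg hd1r.le
    -- the window constant for `ψ⋆`
    obtain ⟨hTs, hTle⟩ := hCw ψ.conductor ψ.primitiveCharacter hξprim hd1 0 1 one_pos le_rfl
    have hTs' : Summable fun ρ : charNontrivialZeros ψ.primitiveCharacter ↦
        (DirichletDisc.zeroOrder ψ.primitiveCharacter (ρ : ℂ) : ℝ) / (1 + (ρ : ℂ).im ^ 2) := by
      refine hTs.congr fun ρ ↦ ?_; simp
    have hTle' : ∑' ρ : charNontrivialZeros ψ.primitiveCharacter,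
        (DirichletDisc.zeroOrder ψ.primitiveCharacter (ρ : ℂ) : ℝ) / (1 + (ρ : ℂ).im ^ 2) ≤ T := by
      have h1 : ∑' ρ : charNontrivialZeros ψ.primitiveCharacter,
          (DirichletDisc.zeroOrder ψ.primitiveCharacter (ρ : ℂ) : ℝ) / (1 + (ρ : ℂ).im ^ 2) =
          ∑' ρ : charNontrivialZeros ψ.primitiveCharacter,
          (DirichletDisc.zeroOrder ψ.primitiveCharacter (ρ : ℂ) : ℝ) / (1 ^ 2 + ((ρ : ℂ).im - 0) ^ 2) :=
        tsum_congr fun ρ ↦ by simp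
      rw [h1]
      refine hTle.trans ?_
      simp only [one_pow, div_one, abs_zero, zero_add]
      rw [hT, hℓ]
      exact mul_le_mul_of_nonneg_left (by linarith) hCw0.le
    -- Part C for the real and imaginary parts
    have hsupp_re : ∀ x : ℝ, (V x).re ≠ 0 → 1 ≤ x ∧ x ≤ 2 := fun x hx ↦ hsupp x (fun h ↦ hx (by simp [h]))
    have hsupp_im : ∀ x : ℝ, (V x).im ≠ 0 → 1 ≤ x ∧ x ≤ 2 := fun x hx ↦ hsupp x (fun h ↦ hx (by simp [h]))
    have hM0re : ∀ x, ‖(((V x).re : ℝ) : ℂ)‖ ≤ M0 := fun x ↦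
      le_trans (by simpa using Complex.abs_re_le_norm (V x)) (hM0V x)
    have hM0im : ∀ x, ‖(((V x).im : ℝ) : ℂ)‖ ≤ M0 := fun x ↦
      le_trans (by simpa using Complex.abs_im_le_norm (V x)) (hM0V x)
    have hMjre : ∀ x, ‖iteratedDeriv j (fun x ↦ (((V x).re : ℝ) : ℂ)) x‖ ≤ Mj := fun x ↦
      (norm_iteratedDeriv_re_le hV j x).trans (hMjV x)
    have hMjim : ∀ x, ‖iteratedDeriv j (fun x ↦ (((V x).im : ℝ) : ℂ)) x‖ ≤ Mj := fun x ↦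
      (norm_iteratedDeriv_im_le hV j x).trans (hMjV x)
    have hM2re : ∀ x, ‖iteratedDeriv 2 (fun x ↦ (((V x).re : ℝ) : ℂ)) x‖ ≤ M2 := fun x ↦
      (norm_iteratedDeriv_re_le hV 2 x).trans (hM2V x)
    have hM2im : ∀ x, ‖iteratedDeriv 2 (fun x ↦ (((V x).im : ℝ) : ℂ)) x‖ ≤ M2 := fun x ↦
      (norm_iteratedDeriv_im_le hV 2 x).trans (hM2V x)
    have hCre := norm_tsum_vonMangoldt_mul_le (W := fun x ↦ (V x).re) hξprim hd1 (contDiff_re hV)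
      (contDiff_re_ofReal hV) hsupp_re hK1 hH1 hj2 hM0re hMjre hTs' hTle'
    have hCim := norm_tsum_vonMangoldt_mul_le (W := fun x ↦ (V x).im) hξprim hd1 (contDiff_im hV)
      (contDiff_im_ofReal hV) hsupp_im hK1 hH1 hj2 hM0im hMjim hTs' hTle'
    -- the left-line remainders
    have hJre : ‖charEFRemainder ψ.primitiveCharacter
        (fun u : ℝ ↦ (V (rexp u / K)).re * rexp (5 / 4 * u)) (5 / 4 : ℂ)‖ ≤ CJ * (25 / 4 * M2) * ℓ := by
      have h := hCJ ψ.conductor ψ.primitiveCharacter hξprim hd1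
        (fun u : ℝ ↦ (V (rexp u / K)).re * rexp (5 / 4 * u)) (5 / 4 : ℂ) (25 / 4 * M2)
        (mul_nonneg (by norm_num) hM20) (by norm_num) (fun y ↦ norm_fordLaplace₀_smoothing_leftLine (W := fun x ↦ (V x).re)
          (contDiff_re_ofReal hV) hsupp_re hK1 hM2re y)
      refine h.trans ?_
      have : Real.log (ψ.conductor : ℝ) + Real.log (1 + |(5 / 4 : ℂ).im|) ≤ ℓ := by
        simp only [show (5 / 4 : ℂ).im = 0 by norm_num, abs_zero, add_zero, Real.log_one]
        rw [hℓ]; linarith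
      exact mul_le_mul_of_nonneg_left this (mul_nonneg hCJ0.le (mul_nonneg (by norm_num) hM20))
    have hJim : ‖charEFRemainder ψ.primitiveCharacter
        (fun u : ℝ ↦ (V (rexp u / K)).im * rexp (5 / 4 * u)) (5 / 4 : ℂ)‖ ≤ CJ * (25 / 4 * M2) * ℓ := by
      have h := hCJ ψ.conductor ψ.primitiveCharacter hξprim hd1
        (fun u : ℝ ↦ (V (rexp u / K)).im * rexp (5 / 4 * u)) (5 / 4 : ℂ) (25 / 4 * M2)
        (mul_nonneg (by norm_num) hM20) (by norm_num) (fun y ↦ norm_fordLaplace₀_smoothing_leftLine (W := fun x ↦ (V x).im)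
          (contDiff_im_ofReal hV) hsupp_im hK1 hM2im y)
      refine h.trans ?_
      have : Real.log (ψ.conductor : ℝ) + Real.log (1 + |(5 / 4 : ℂ).im|) ≤ ℓ := by
        simp only [show (5 / 4 : ℂ).im = 0 by norm_num, abs_zero, add_zero, Real.log_one]
        rw [hℓ]; linarith
      exact mul_le_mul_of_nonneg_left this (mul_nonneg hCJ0.le (mul_nonneg (by norm_num) hM20))
    -- the layer term is `S3 ψ`
    have hS3eq : (∑ z ∈ (lfunctionZeroBox_finite (ExplicitPsiChar.ne_one_of_isPrimitive hξprim hd1) H).toFinset,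
        if 1 / 2 < z.re then (DirichletDisc.zeroOrder ψ.primitiveCharacter z : ℝ) * K ^ (z.re - 1) else 0) =
        S3 ψ := by
      rw [hS3]
      simp only [dif_neg ψ.conductor_ne_zero, dif_neg hξ1]
    -- the imprimitive correction
    have hcorr := norm_sum_sub_tsum_primitive_le ψ hsupp hM0V hK1.le
    have hω : (q.primeFactors.card : ℝ) ≤ q := by
      have h1 : q.primeFactors.card ≤ q.divisors.card := by
        rw [Nat.primeFactors_eq_to_filter_divisors_prime]
        exact Finset.card_filter_le _ _
      exact_mod_cast h1.trans (Nat.card_divisors_le_self q)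
    have hNlog := natLog_floor_add_one_le hK1.le
    have hcorr' : ‖∑ n ∈ Finset.Icc 1 N, ((Λ n : ℝ) : ℂ) * ψ (n : ZMod q) * V ((n : ℝ) / K) -
        ∑' n : ℕ, ((Λ n : ℝ) : ℂ) * ψ.primitiveCharacter n * V ((n : ℝ) / K)‖ ≤
        M0 * ((q : ℝ) * (4 * Real.log (2 * K)) * Real.log q) := by
      refine hcorr.trans (mul_le_mul_of_nonneg_left ?_ hM00)
      have hlog2K : 0 ≤ Real.log (2 * K) := Real.log_nonneg (by linarith)
      exact mul_le_mul (mul_le_mul hω hNlog (by positivity) hq0.le) le_rfl hlogq.le (by positivity)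
    -- real/imaginary split of the primitive sum
    have hsplit := norm_sum_le_re_add_im (fun n ↦ ψ.primitiveCharacter n) V (Finset.Icc 1 N) K
    have hre_eq : ∑ n ∈ Finset.Icc 1 N, ((Λ n : ℝ) : ℂ) * ψ.primitiveCharacter n *
        (((V ((n : ℝ) / K)).re : ℝ) : ℂ) =
        ∑' n : ℕ, ((Λ n : ℝ) : ℂ) * ψ.primitiveCharacter n * (((V ((n : ℝ) / K)).re : ℝ) : ℂ) := by
      have := tsum_eq_sum_Icc (fun n ↦ ψ.primitiveCharacter n) (V := fun x ↦ (((V x).re : ℝ) : ℂ))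
        (fun x hx ↦ hsupp_re x (by simpa using hx)) hK0
      exact this.symm
    have him_eq : ∑ n ∈ Finset.Icc 1 N, ((Λ n : ℝ) : ℂ) * ψ.primitiveCharacter n *
        (((V ((n : ℝ) / K)).im : ℝ) : ℂ) =
        ∑' n : ℕ, ((Λ n : ℝ) : ℂ) * ψ.primitiveCharacter n * (((V ((n : ℝ) / K)).im : ℝ) : ℂ) := by
      have := tsum_eq_sum_Icc (fun n ↦ ψ.primitiveCharacter n) (V := fun x ↦ (((V x).im : ℝ) : ℂ))
        (fun x hx ↦ hsupp_im x (by simpa using hx)) hK0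
      exact this.symm
    have hprim_eq := tsum_eq_sum_Icc (fun n ↦ ψ.primitiveCharacter n) hsupp hK0 (V := V)
    -- assemble
    have hA1 : ‖∑ n ∈ Finset.Icc 1 N, ((Λ n : ℝ) : ℂ) * ψ (n : ZMod q) * V ((n : ℝ) / K)‖ ≤
        ‖∑' n : ℕ, ((Λ n : ℝ) : ℂ) * ψ.primitiveCharacter n * V ((n : ℝ) / K)‖ +
          M0 * ((q : ℝ) * (4 * Real.log (2 * K)) * Real.log q) := by
      have := norm_sub_norm_le (∑ n ∈ Finset.Icc 1 N, ((Λ n : ℝ) : ℂ) * ψ (n : ZMod q) * V ((n : ℝ) / K))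
        (∑' n : ℕ, ((Λ n : ℝ) : ℂ) * ψ.primitiveCharacter n * V ((n : ℝ) / K))
      linarith [hcorr']
    rw [hprim_eq] at hA1
    rw [hre_eq, him_eq] at hsplit
    rw [hS3eq] at hCre hCim
    linarith [hA1, hsplit, hCre, hCim, hJre, hJim]
  ---------------------------------------------------------------------------------------------
  -- Step 2: the layer terms via `prop2` at each conductor, and the sum over `ψ`
  ---------------------------------------------------------------------------------------------
  set Y : ℝ := ((q : ℝ) * H) ^ (7 / 3 : ℝ) with hY
  set D : ℝ := C2 * ((q : ℝ) * H) ^ ε₂ with hD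
  have hqH0 : 0 < (q : ℝ) * H := by positivity
  have hqH1 : 1 ≤ (q : ℝ) * H := one_le_mul_of_one_le_of_one_le hq1 hH1
  have hY1 : 1 ≤ Y := Real.one_le_rpow hqH1 (by norm_num)
  have hD0 : 0 ≤ D := by positivity
  have hqH : (q : ℝ) * H = (q : ℝ) ^ (1 + b) := by rw [hH, Real.rpow_add hq0, Real.rpow_one]
  have hYq : Y = (q : ℝ) ^ (7 / 3 + η) := by
    rw [hY, hqH, ← Real.rpow_mul hq0.le]; congr 1; rw [hb]; ring
  have hq1' : (1 : ℝ) < q := by linarith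
  have hYK : Y < K := by
    rw [hYq]
    exact lt_of_lt_of_le (Real.rpow_lt_rpow_of_exponent_lt hq1' (by linarith)) hK
  have hN : ∀ d ∈ q.divisors, ∀ (_ : NeZero d), ∀ σ : ℝ, 1 / 2 ≤ σ → σ < 1 →
      ∑ ξ ∈ (Finset.univ.filter fun ξ : DirichletCharacter ℂ d ↦ ξ.IsPrimitive),
        (charZeroCountRe ξ σ H : ℝ) ≤ D * Y ^ (1 - σ) := by
    intro d hd _ σ hσ hσ1
    have hdq : (d : ℝ) ≤ q := by exact_mod_cast Nat.divisor_le hd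
    have hd0 : (0 : ℝ) ≤ d := Nat.cast_nonneg d
    have h := hC2 d σ H hσ hσ1 hH1
    refine h.trans ?_
    have he : 0 ≤ 7 * (1 - σ) / 3 + ε₂ := by
      have : 0 ≤ 1 - σ := by linarith
      positivity
    calc C2 * ((d : ℝ) * H) ^ (7 * (1 - σ) / 3 + ε₂) ≤ C2 * ((q : ℝ) * H) ^ (7 * (1 - σ) / 3 + ε₂) := by
          refine mul_le_mul_of_nonneg_left (Real.rpow_le_rpow (by positivity) ?_ he) hC20.le
          exact mul_le_mul_of_nonneg_right hdq hH0.le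
      _ = D * Y ^ (1 - σ) := by
          rw [hD, hY, ← Real.rpow_mul hqH0.le, Real.rpow_add hqH0, mul_assoc, mul_comm (((q : ℝ) * H) ^ _)]
          congr 2
          ring_nf
  have hlayer : ∑ ψ ∈ F1, S3 ψ ≤ (q.divisors.card : ℝ) * (D + Real.log K * (D / Real.log (K / Y))) :=
    sum_layer_le_card_divisors_mul hK1 hY1 hYK hD0 hN
  -- summing the per-character bounds
  have hR0 : 0 ≤ R := by
    have : 0 ≤ Real.log (2 * K) := Real.log_nonneg (by linarith)
    positivity
  have hsumF : ∑ ψ ∈ F, ‖∑ n ∈ Finset.Icc 1 N, ((Λ n : ℝ) : ℂ) * ψ (n : ZMod q) * V ((n : ℝ) / K)‖ ≤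
      ∑ ψ ∈ F1, ‖∑ n ∈ Finset.Icc 1 N, ((Λ n : ℝ) : ℂ) * ψ (n : ZMod q) * V ((n : ℝ) / K)‖ :=
    Finset.sum_le_sum_of_subset_of_nonneg hFF1 fun _ _ _ ↦ norm_nonneg _
  have hsumF1 : ∑ ψ ∈ F1, ‖∑ n ∈ Finset.Icc 1 N, ((Λ n : ℝ) : ℂ) * ψ (n : ZMod q) * V ((n : ℝ) / K)‖ ≤
      (q : ℝ) * R + 2 * (K * M0) * ((q.divisors.card : ℝ) * (D + Real.log K * (D / Real.log (K / Y)))) := by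
    refine (Finset.sum_le_sum hper).trans ?_
    rw [Finset.sum_add_distrib, Finset.sum_const, nsmul_eq_mul, ← Finset.mul_sum, ← Finset.mul_sum]
    have hcard : (F1.card : ℝ) ≤ q := card_filter_ne_one_le q
    have h1 : (F1.card : ℝ) * R ≤ q * R := mul_le_mul_of_nonneg_right hcard hR0
    have h2 : 2 * (K * M0 * ∑ ψ ∈ F1, S3 ψ) ≤
        2 * (K * M0) * ((q.divisors.card : ℝ) * (D + Real.log K * (D / Real.log (K / Y)))) := by
      rw [mul_assoc (2 : ℝ) (K * M0)]
      exact mul_le_mul_of_nonneg_left (mul_le_mul_of_nonneg_left hlayer (by positivity)) (by norm_num)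
    linarith
  ---------------------------------------------------------------------------------------------
  -- Step 3: bookkeeping of the powers of `q` and `K`
  ---------------------------------------------------------------------------------------------
  set qe : ℝ := (q : ℝ) ^ (ε / 4) with hqe
  have hqe1 : 1 ≤ qe := Real.one_le_rpow hq1 (by positivity)
  -- (f1) `log q ≤ (4/ε) q^{ε/4}`
  have hf1 : Real.log q ≤ 4 / ε * qe := by
    calc Real.log q ≤ (q : ℝ) ^ (ε / 4) / (ε / 4) := Real.log_le_rpow_div hq0.le (by positivity)
      _ = 4 / ε * qe := by rw [hqe, div_div_eq_mul_div]; ring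
  -- (f2) `ℓ ≤ (12/ε) q^{ε/4}`, `T ≤ Cw (12/ε) q^{ε/4}`
  have hℓ3 : ℓ ≤ 3 * Real.log q := by
    have : Real.log 4 ≤ 2 * Real.log q := by
      rw [show (4 : ℝ) = 2 ^ 2 by norm_num, Real.log_pow]; push_cast
      exact mul_le_mul_of_nonneg_left (Real.log_le_log two_pos hq2r) (by norm_num)
    rw [hℓ]; linarith
  have hf2 : ℓ ≤ 12 / ε * qe := by
    calc ℓ ≤ 3 * Real.log q := hℓ3
      _ ≤ 3 * (4 / ε * qe) := by gcongr
      _ = 12 / ε * qe := by ring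
  have hf2T : T ≤ Cw * (12 / ε * qe) := mul_le_mul_of_nonneg_left hf2 hCw0.le
  -- (f3) `log(2K) ≤ 14 K^{1/7}`
  have hf3 : Real.log (2 * K) ≤ 14 * K ^ (1 / 7 : ℝ) := by
    have h1 := Real.log_le_rpow_div (by linarith : (0 : ℝ) ≤ 2 * K) (by norm_num : (0 : ℝ) < 1 / 7)
    have h2 : (2 * K) ^ (1 / 7 : ℝ) = (2 : ℝ) ^ (1 / 7 : ℝ) * K ^ (1 / 7 : ℝ) :=
      Real.mul_rpow (by norm_num) hK0.le
    have h3 : (2 : ℝ) ^ (1 / 7 : ℝ) ≤ 2 := by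
      conv_rhs => rw [← Real.rpow_one 2]
      exact Real.rpow_le_rpow_of_exponent_le one_le_two (by norm_num)
    have h4 : 0 ≤ K ^ (1 / 7 : ℝ) := Real.rpow_nonneg hK0.le _
    calc Real.log (2 * K) ≤ (2 * K) ^ (1 / 7 : ℝ) / (1 / 7) := h1
      _ = 7 * ((2 : ℝ) ^ (1 / 7 : ℝ) * K ^ (1 / 7 : ℝ)) := by rw [h2]; ring
      _ ≤ 7 * (2 * K ^ (1 / 7 : ℝ)) := by gcongr
      _ = 14 * K ^ (1 / 7 : ℝ) := by ring
  -- (f4) `q² ≤ K^{6/7}` and `q² K^{1/7} ≤ K`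
  have hK73 : (q : ℝ) ^ (7 / 3 : ℝ) ≤ K :=
    le_trans (Real.rpow_le_rpow_of_exponent_le hq1 (by linarith)) hK
  have hf4 : (q : ℝ) ^ 2 * K ^ (1 / 7 : ℝ) ≤ K := by
    have h1 : (q : ℝ) ^ 2 = ((q : ℝ) ^ (7 / 3 : ℝ)) ^ (6 / 7 : ℝ) := by
      rw [← Real.rpow_mul hq0.le, ← Real.rpow_natCast]; norm_num
    have h2 : ((q : ℝ) ^ (7 / 3 : ℝ)) ^ (6 / 7 : ℝ) ≤ K ^ (6 / 7 : ℝ) :=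
      Real.rpow_le_rpow (by positivity) hK73 (by norm_num)
    calc (q : ℝ) ^ 2 * K ^ (1 / 7 : ℝ) ≤ K ^ (6 / 7 : ℝ) * K ^ (1 / 7 : ℝ) := by
          rw [h1]; exact mul_le_mul_of_nonneg_right h2 (Real.rpow_nonneg hK0.le _)
      _ = K := by rw [← Real.rpow_add hK0]; norm_num
  -- (f5) `q ≤ H^{j-2}`
  have hf5 : (q : ℝ) ≤ H ^ (j - 2) := by
    rw [hH, ← Real.rpow_natCast, ← Real.rpow_mul hq0.le]
    conv_lhs => rw [← Real.rpow_one (q : ℝ)]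
    exact Real.rpow_le_rpow_of_exponent_le hq1 hbj
  -- (f6) `K^{1/2} q^{1+2b} ≤ K`
  have hf6 : K ^ (1 / 2 : ℝ) * (q : ℝ) ^ (1 + 2 * b) ≤ K := by
    have h1 : (q : ℝ) ^ (1 + 2 * b) ≤ K ^ (1 / 2 : ℝ) := by
      have h2 : (q : ℝ) ^ (1 + 2 * b) ≤ ((q : ℝ) ^ (7 / 3 + 2 * η)) ^ (1 / 2 : ℝ) := by
        rw [← Real.rpow_mul hq0.le]
        exact Real.rpow_le_rpow_of_exponent_le hq1 (by rw [hb]; nlinarith)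
      exact h2.trans (Real.rpow_le_rpow (by positivity) hK (by norm_num))
    calc K ^ (1 / 2 : ℝ) * (q : ℝ) ^ (1 + 2 * b) ≤ K ^ (1 / 2 : ℝ) * K ^ (1 / 2 : ℝ) :=
          mul_le_mul_of_nonneg_left h1 (Real.rpow_nonneg hK0.le _)
      _ = K := by rw [← Real.rpow_add hK0]; norm_num
  -- (f7) `q (1 + H²) ≤ 2 q^{1+2b}`
  have hf7 : (q : ℝ) * (1 + H ^ 2) ≤ 2 * (q : ℝ) ^ (1 + 2 * b) := by
    have h1 : H ^ 2 = (q : ℝ) ^ (2 * b) := by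
      rw [hH, ← Real.rpow_natCast, ← Real.rpow_mul hq0.le]; congr 1; push_cast; ring
    have h2 : 1 ≤ H ^ 2 := one_le_pow₀ hH1
    calc (q : ℝ) * (1 + H ^ 2) ≤ (q : ℝ) * (2 * H ^ 2) := by gcongr; linarith
      _ = 2 * ((q : ℝ) ^ (1 : ℝ) * (q : ℝ) ^ (2 * b)) := by rw [h1, Real.rpow_one]; ring
      _ = 2 * (q : ℝ) ^ (1 + 2 * b) := by rw [← Real.rpow_add hq0]
  -- (f8) the divisor bound
  have hf8 : (q.divisors.card : ℝ) ≤ Cd * qe := hCd q (NeZero.ne q)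
  -- (f9) `D = C2 q^{ε/4}`
  have hf9 : D = C2 * qe := by
    rw [hD, hqH, ← Real.rpow_mul hq0.le, hqe]
    congr 2
    rw [hε₂]; field_simp
  -- (f10) `log K · D / log(K/Y) ≤ D (7/3 + 2η)/η`
  have hlogK : 0 < Real.log K := Real.log_pos hK1
  have hlogKY : 0 < Real.log (K / Y) := Real.log_pos ((one_lt_div (by linarith)).2 hYK)
  have hf10 : Real.log K * (D / Real.log (K / Y)) ≤ D * ((7 / 3 + 2 * η) / η) := by
    have hY0 : 0 < Y := by linarith
    have hlogY : Real.log Y = (7 / 3 + η) * Real.log q := by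
      rw [hYq, Real.log_rpow hq0]
    have hlogKq : (7 / 3 + 2 * η) * Real.log q ≤ Real.log K := by
      have := Real.log_le_log (by positivity) hK
      rwa [Real.log_rpow hq0] at this
    have hKY : Real.log (K / Y) = Real.log K - Real.log Y := Real.log_div hK0.ne' hY0.ne'
    -- `log(K/Y) ≥ (η/(7/3+2η)) log K`
    have hlow : η / (7 / 3 + 2 * η) * Real.log K ≤ Real.log (K / Y) := by
      rw [hKY, hlogY]
      have h73 : 0 < 7 / 3 + 2 * η := by positivity
      rw [div_mul_eq_mul_div, div_le_iff₀ h73]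
      have hm := mul_le_mul_of_nonneg_left hlogKq (by positivity : (0 : ℝ) ≤ 7 / 3 + η)
      linear_combination hm
    have hpos : 0 < Real.log (K / Y) := Real.log_pos ((one_lt_div hY0).2 hYK)
    rw [mul_div_assoc', div_le_iff₀ hpos]
    have h73 : 0 < 7 / 3 + 2 * η := by positivity
    calc Real.log K * D = D * ((7 / 3 + 2 * η) / η) * (η / (7 / 3 + 2 * η) * Real.log K) := by
          field_simp
      _ ≤ D * ((7 / 3 + 2 * η) / η) * Real.log (K / Y) :=
          mul_le_mul_of_nonneg_left hlow (by positivity)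
  -- (f11) monotonicity in the exponent
  have hqe2 : qe * qe = (q : ℝ) ^ (ε / 2) := by rw [hqe, ← Real.rpow_add hq0]; ring_nf
  have hqe3 : qe * qe * qe = (q : ℝ) ^ (3 * ε / 4) := by
    rw [hqe, ← Real.rpow_add hq0, ← Real.rpow_add hq0]; ring_nf
  have hε2le : (q : ℝ) ^ (ε / 2) ≤ (q : ℝ) ^ ε := Real.rpow_le_rpow_of_exponent_le hq1 (by linarith)
  have hε4le : qe ≤ (q : ℝ) ^ ε := Real.rpow_le_rpow_of_exponent_le hq1 (by linarith)
  have hε34le : (q : ℝ) ^ (3 * ε / 4) ≤ (q : ℝ) ^ ε := Real.rpow_le_rpow_of_exponent_le hq1 (by linarith)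
  have hqε0 : 0 < (q : ℝ) ^ ε := by positivity
  ---------------------------------------------------------------------------------------------
  -- Step 4: the six terms
  ---------------------------------------------------------------------------------------------
  have hKA : 0 ≤ K * (q : ℝ) ^ ε := by positivity
  -- T1: the imprimitive corrections
  have hT1 : (q : ℝ) * (M0 * ((q : ℝ) * (4 * Real.log (2 * K)) * Real.log q)) ≤
      A' * (224 / ε) * (K * (q : ℝ) ^ ε) := by
    have h1 : (q : ℝ) * (M0 * ((q : ℝ) * (4 * Real.log (2 * K)) * Real.log q)) =
        4 * (q : ℝ) ^ 2 * M0 * Real.log (2 * K) * Real.log q := by ring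
    rw [h1]
    have hlog2K : 0 ≤ Real.log (2 * K) := Real.log_nonneg (by linarith)
    calc 4 * (q : ℝ) ^ 2 * M0 * Real.log (2 * K) * Real.log q
        ≤ 4 * (q : ℝ) ^ 2 * (A' * qe) * (14 * K ^ (1 / 7 : ℝ)) * (4 / ε * qe) := by
          gcongr
      _ = A' * (224 / ε) * (((q : ℝ) ^ 2 * K ^ (1 / 7 : ℝ)) * (qe * qe)) := by ring
      _ ≤ A' * (224 / ε) * (K * (q : ℝ) ^ ε) := by
          rw [hqe2]
          refine mul_le_mul_of_nonneg_left ?_ (by positivity)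
          exact mul_le_mul hf4 hε2le (by positivity) hK0.le
  -- T2: the far zeros
  have hT2 : (q : ℝ) * (2 * (K * (2 ^ (j + 1) * Mj / H ^ (j - 2)) * T)) ≤
      A' * (2 ^ (j + 2) * 12 * Cw / ε) * (K * (q : ℝ) ^ ε) := by
    have hHj : 0 < H ^ (j - 2) := pow_pos hH0 _
    have h1 : (q : ℝ) * (2 * (K * (2 ^ (j + 1) * Mj / H ^ (j - 2)) * T)) =
        2 ^ (j + 2) * K * Mj * T * ((q : ℝ) / H ^ (j - 2)) := by
      rw [pow_succ 2 (j + 1)]; field_simp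
    rw [h1]
    have hqH' : (q : ℝ) / H ^ (j - 2) ≤ 1 := (div_le_one hHj).2 hf5
    calc 2 ^ (j + 2) * K * Mj * T * ((q : ℝ) / H ^ (j - 2))
        ≤ 2 ^ (j + 2) * K * (A' * qe) * (Cw * (12 / ε * qe)) * 1 := by
          gcongr
      _ = A' * (2 ^ (j + 2) * 12 * Cw / ε) * (K * (qe * qe)) := by ring
      _ ≤ A' * (2 ^ (j + 2) * 12 * Cw / ε) * (K * (q : ℝ) ^ ε) := by
          rw [hqe2]
          refine mul_le_mul_of_nonneg_left (mul_le_mul_of_nonneg_left hε2le hK0.le) (by positivity)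
  -- T3: the zeros with `β ≤ 1/2`
  have hT3 : (q : ℝ) * (2 * (K ^ (1 / 2 : ℝ) * M0 * (1 + H ^ 2) * T)) ≤
      A' * (48 * Cw / ε) * (K * (q : ℝ) ^ ε) := by
    have h1 : (q : ℝ) * (2 * (K ^ (1 / 2 : ℝ) * M0 * (1 + H ^ 2) * T)) =
        2 * K ^ (1 / 2 : ℝ) * M0 * T * ((q : ℝ) * (1 + H ^ 2)) := by ring
    rw [h1]
    have hK12 : 0 ≤ K ^ (1 / 2 : ℝ) := Real.rpow_nonneg hK0.le _
    calc 2 * K ^ (1 / 2 : ℝ) * M0 * T * ((q : ℝ) * (1 + H ^ 2))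
        ≤ 2 * K ^ (1 / 2 : ℝ) * (A' * qe) * (Cw * (12 / ε * qe)) * (2 * (q : ℝ) ^ (1 + 2 * b)) := by
          gcongr
      _ = A' * (48 * Cw / ε) * ((K ^ (1 / 2 : ℝ) * (q : ℝ) ^ (1 + 2 * b)) * (qe * qe)) := by ring
      _ ≤ A' * (48 * Cw / ε) * (K * (q : ℝ) ^ ε) := by
          rw [hqe2]
          refine mul_le_mul_of_nonneg_left ?_ (by positivity)
          exact mul_le_mul hf6 hε2le (by positivity) hK0.le
  -- T4: the trivial zeros
  have hT4 : (q : ℝ) * (2 * (2 * M0)) ≤ A' * 4 * (K * (q : ℝ) ^ ε) := by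
    calc (q : ℝ) * (2 * (2 * M0)) ≤ K * (2 * (2 * (A' * qe))) := by gcongr
      _ = A' * 4 * (K * qe) := by ring
      _ ≤ A' * 4 * (K * (q : ℝ) ^ ε) := by
          refine mul_le_mul_of_nonneg_left (mul_le_mul_of_nonneg_left hε4le hK0.le) (by positivity)
  -- T5: the left line
  have hT5 : (q : ℝ) * (2 * (CJ * (25 / 4 * M2) * ℓ)) ≤ A' * (150 * CJ / ε) * (K * (q : ℝ) ^ ε) := by
    have h1 : (q : ℝ) * (2 * (CJ * (25 / 4 * M2) * ℓ)) = 25 / 2 * CJ * M2 * ℓ * q := by ring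
    rw [h1]
    calc 25 / 2 * CJ * M2 * ℓ * q ≤ 25 / 2 * CJ * (A' * qe) * (12 / ε * qe) * K := by gcongr
      _ = A' * (150 * CJ / ε) * (K * (qe * qe)) := by ring
      _ ≤ A' * (150 * CJ / ε) * (K * (q : ℝ) ^ ε) := by
          rw [hqe2]
          refine mul_le_mul_of_nonneg_left (mul_le_mul_of_nonneg_left hε2le hK0.le) (by positivity)
  -- T6: the layer cake
  have hT6 : 2 * (K * M0) * ((q.divisors.card : ℝ) * (D + Real.log K * (D / Real.log (K / Y)))) ≤
      A' * (2 * Cd * C2 * cη) * (K * (q : ℝ) ^ ε) := by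
    have h1 : D + Real.log K * (D / Real.log (K / Y)) ≤ D * cη := by
      rw [hcη, mul_add, mul_one]; linarith [hf10]
    have hX0 : 0 ≤ D + Real.log K * (D / Real.log (K / Y)) :=
      add_nonneg hD0 (mul_nonneg hlogK.le (div_nonneg hD0 hlogKY.le))
    have h2 : (q.divisors.card : ℝ) * (D + Real.log K * (D / Real.log (K / Y))) ≤ (Cd * qe) * (D * cη) :=
      mul_le_mul hf8 h1 hX0 (by positivity)
    have h3 : 2 * (K * M0) ≤ 2 * (K * (A' * qe)) :=
      mul_le_mul_of_nonneg_left (mul_le_mul_of_nonneg_left hM0le hK0.le) (by norm_num)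
    calc 2 * (K * M0) * ((q.divisors.card : ℝ) * (D + Real.log K * (D / Real.log (K / Y))))
        ≤ 2 * (K * (A' * qe)) * ((Cd * qe) * (D * cη)) :=
          mul_le_mul h3 h2 (mul_nonneg (Nat.cast_nonneg _) hX0) (by positivity)
      _ = A' * (2 * Cd * C2 * cη) * (K * (qe * qe * qe)) := by rw [hf9]; ring
      _ ≤ A' * (2 * Cd * C2 * cη) * (K * (q : ℝ) ^ ε) := by
          rw [hqe3]
          refine mul_le_mul_of_nonneg_left (mul_le_mul_of_nonneg_left hε34le hK0.le) (by positivity)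
  -- conclusion
  have hRq : (q : ℝ) * R = (q : ℝ) * (M0 * ((q : ℝ) * (4 * Real.log (2 * K)) * Real.log q)) +
      ((q : ℝ) * (2 * (K * (2 ^ (j + 1) * Mj / H ^ (j - 2)) * T)) +
        (q : ℝ) * (2 * (K ^ (1 / 2 : ℝ) * M0 * (1 + H ^ 2) * T)) +
        (q : ℝ) * (2 * (2 * M0)) + (q : ℝ) * (2 * (CJ * (25 / 4 * M2) * ℓ))) := by
    rw [hR]; ring
  have hCK : C * K * (q : ℝ) ^ ε = A' * (224 / ε) * (K * (q : ℝ) ^ ε) +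
      A' * (2 ^ (j + 2) * 12 * Cw / ε) * (K * (q : ℝ) ^ ε) + A' * (48 * Cw / ε) * (K * (q : ℝ) ^ ε) +
      A' * 4 * (K * (q : ℝ) ^ ε) + A' * (150 * CJ / ε) * (K * (q : ℝ) ^ ε) +
      A' * (2 * Cd * C2 * cη) * (K * (q : ℝ) ^ ε) := by
    rw [hC]; ring
  calc ∑ ψ ∈ F, ‖∑ n ∈ Finset.Icc 1 N, ((Λ n : ℝ) : ℂ) * ψ (n : ZMod q) * V ((n : ℝ) / K)‖
      ≤ (q : ℝ) * R + 2 * (K * M0) * ((q.divisors.card : ℝ) * (D + Real.log K * (D / Real.log (K / Y)))) :=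
        hsumF.trans hsumF1
    _ ≤ C * K * (q : ℝ) ^ ε := by rw [hRq, hCK]; linarith [hT1, hT2, hT3, hT4, hT5, hT6]

/-- **Bondarenko–Heap 2026, Lemma 10, from Proposition 2.** The averaged prime-sum bound
`∑_{ψ mod q, ψ ∉ {ψ₀,χ}} |∑_n Λ(n)ψ(n)V(n/K)| ≪_{η,ε} K q^ε` (`K ≥ q^{7/3+2η}`, `V` smooth on `[1,2]`
with `‖V^{(j)}‖_∞ ≪_j q^{ε₁}`) follows from the zero-density estimate `prop2` (Chen–Gupta–Li,
exponent `7/3`): the instantiation `ε₁ = ε/4` of `lemma10_of_prop2_of_derivBounds` (the typed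
hypothesis bounds every derivative; the proof uses the orders `0, 2, ⌈7/(3η)⌉ + 3`). The constant
depends on `η`, `ε` and the profile `A` of `V`, as in the typed statement.
[cite: BondarenkoHeap2026, Lemma 10] -/
theorem lemma10_of_prop2 (h2 : prop2) : lemma10 := by
  intro η hη ε hε
  refine ⟨ε / 4, by positivity, fun A ↦ ?_⟩
  obtain ⟨C, hC, h⟩ := lemma10_of_prop2_of_derivBounds h2 hη hε A
  refine ⟨C, hC, fun q _ χ hχ hχ2 K hK V hV hsupp hAV ↦ ?_⟩
  exact h q χ hχ hχ2 K hK V hV hsupp fun i x _ ↦ hAV i x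

/-- **Bondarenko–Heap 2026, Lemma 10 over the primed weight clause, from Proposition 2**
(`lemma10'`, `BondarenkoHeap2026Section6Weights`: loss `(q^{ε₁})^j` at order `j`, as the §6.2
Mellin-separated weights `ω(x)x^{−s}` satisfy; rh-crit/ah E-ah-3 correction block): a corollary of
`lemma10_of_prop2_of_derivBounds` with `ε₁ = ε/(4J(η))`, `J(η) = ⌈7/(3η)⌉ + 3`, since the proof
uses only the orders `i ≤ J(η)` and `(q^{ε₁})^i ≤ q^{ε/4}` there (and `A ↦ |A|`).
[cite: BondarenkoHeap2026, Lemma 10] -/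
theorem lemma10'_of_prop2 (h2 : prop2) : lemma10' := by
  intro η hη ε hε
  have hJpos : (0 : ℝ) < ((⌈7 / (3 * η)⌉₊ + 3 : ℕ) : ℝ) := by positivity
  refine ⟨ε / (4 * ((⌈7 / (3 * η)⌉₊ + 3 : ℕ) : ℝ)), by positivity, fun A ↦ ?_⟩
  obtain ⟨C, hC, h⟩ := lemma10_of_prop2_of_derivBounds h2 hη hε (fun i ↦ |A i|)
  refine ⟨C, hC, fun q _ χ hχ hχ2 K hK V hV hsupp hAV ↦
    h q χ hχ hχ2 K hK V hV hsupp fun i x hi ↦ ?_⟩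
  have hq1 : (1 : ℝ) ≤ q := by exact_mod_cast NeZero.one_le
  have hq0 : (0 : ℝ) ≤ q := by positivity
  have hi' : (i : ℝ) ≤ ((⌈7 / (3 * η)⌉₊ + 3 : ℕ) : ℝ) := by exact_mod_cast hi
  have hpow : ((q : ℝ) ^ (ε / (4 * ((⌈7 / (3 * η)⌉₊ + 3 : ℕ) : ℝ)))) ^ i ≤ (q : ℝ) ^ (ε / 4) := by
    rw [← Real.rpow_natCast, ← Real.rpow_mul hq0]
    refine Real.rpow_le_rpow_of_exponent_le hq1 ?_
    rw [div_mul_eq_mul_div, div_le_div_iff₀ (by positivity) (by positivity)]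
    nlinarith [hε.le, hi']
  have h0 : 0 ≤ ((q : ℝ) ^ (ε / (4 * ((⌈7 / (3 * η)⌉₊ + 3 : ℕ) : ℝ)))) ^ i := by positivity
  calc ‖iteratedDeriv i V x‖ ≤ A i * ((q : ℝ) ^ (ε / (4 * ((⌈7 / (3 * η)⌉₊ + 3 : ℕ) : ℝ)))) ^ i :=
        hAV i x
    _ ≤ |A i| * ((q : ℝ) ^ (ε / (4 * ((⌈7 / (3 * η)⌉₊ + 3 : ℕ) : ℝ)))) ^ i :=
        mul_le_mul_of_nonneg_right (le_abs_self _) h0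
    _ ≤ |A i| * (q : ℝ) ^ (ε / 4) := mul_le_mul_of_nonneg_left hpow (abs_nonneg _)

end Literature.NumberTheory.LFunctions.BondarenkoHeap2026
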